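import Summits.HodgeConjecture.HodgeConjecture.Cruxes.HLiu418.Lines.F0_P6a_PELWitnessEDefs   -- (D) = the E-LINE's DEFINITIONS LAYER (β «M-63», written 772fdc9a4e65): DAG `Defs → leaves → E-line`; through it ★ P-3 ∕ ★ P-1 ∕ ★ (U) ∕ ★ (F)
import Literature.AlgebraicGeometry.ModuliOfAbelianVarieties.SiegelUniversalFamilyPullbackAdmissibleNormalForm   -- ★ p847727 organ O2 ADM-NF (LA7-p01 (g0)): `exists_admPackage_normalForm_of_junction`
import Literature.AlgebraicGeometry.ModuliOfAbelianVarieties.SiegelUniversalFamilyChartAlign   -- ★ p847835 organ O4 ALIGN (LA7-p01 (g0)): `exists_alignedChart_of_frameJLinear`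
import Literature.AlgebraicGeometry.ModuliOfAbelianVarieties.SiegelShimuraSetPrincipalDissection   -- ★ `exists_principalRep` (integral representatives of `c`)
import Literature.AlgebraicGeometry.ModuliOfAbelianVarieties.SiegelUniversalFamilyChartGluing   -- ★ p847935 organ O6 GLUE (LA7-p02 (g0)): `SiegelUniversalFamilyChartGluing.chart_of_local`
import Literature.AlgebraicGeometry.ModuliOfAbelianVarieties.SiegelUniversalFamilyChartMatch   -- ★ p847965 organ O5 MATCH (LA7-p02 (g0)): `SiegelUniversalFamilyChartMatch.match_chart`
import Literature.AlgebraicGeometry.ModuliOfAbelianVarieties.RelativeExponentialChartNormalise   -- ★ p847957 FLAT-a NORM₀ (LA7-p01 (g0)): `SiegelAdelicMarking.exists_normalisedChart`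
import Literature.AlgebraicGeometry.ModuliOfAbelianVarieties.RelativeExponentialChartLevelReadings   -- ★ p848159 FLAT-b(i) (L=) (LA7-p02 (g0)): `levelReading_const`
import Literature.AlgebraicGeometry.ModuliOfAbelianVarieties.RelativeExponentialChartPairingReadingsGlobal   -- ★ p848424 FLAT-b(ii) (W=) (LA7-p02 (g0); (ii-F) ★ p848216 LA7-p01): `pairingReading_const`
import Literature.AlgebraicGeometry.ModuliOfAbelianVarieties.SiegelUniversalFamilyChartPackageOfReadings   -- ★ p848162 FLAT-c (LA7-p01 (g0)): `exists_framePackage_of_readings`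
import Literature.AlgebraicGeometry.ModuliOfAbelianVarieties.SiegelAdmissibleMarkingUniqueTorusTwoReps   -- ★ p848386 FLAT-d (LA7-p01 (g0)): `SiegelAdelicMarking.toFun_eq_toFun_of_lifts₂`
import Literature.Geometry.ComplexAnalytic.RelativeExponentialFlow   -- ★ p849279 (E1) ROAD B FLOW (LA7-plan (g2) pen, A-p15 (g19) filed): `exists_relExpFlow` — B1 p849240 · B2 p849248+p849219 · B3 p849077 · B4 p849045 · O3 p849119 inside
import Literature.Geometry.ComplexAnalytic.RelativeExponentialUniformisationOfFlow   -- ★ p849362 (E2a) FLOW ⇒ P-1 (LA1-plan (g2) pen, LA1-p04 (g2) filed): `relativeExponentialUniformisation_of_exists_relExpFlow` — (L1) p849017 · (L2) p849083 · FILE 3 · O4 p849209 inside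
import HarnessLib

/-!
# `F0_P6a_StubUNIVFAM` — CLOSER SKELETON for the socket `stub_UNIVFAM` of the E-LINE (half A, line L7; SEATPLAN-GO500 v1 §1A row L7)

CRUX `stmt-HodgeConjecture-24832` (HLiu418).  SOCKET (verbatim, E-LINE `Cruxes/HLiu418/Lines/F0_P6a_PELWitnessE.lean` ED. 4 :654; byte-identical in ED. 5 (β)):
`theorem stub_UNIVFAM : Literature.AlgebraicGeometry.ModuliOfAbelianVarieties.siegelUniversalFamilyUniformisation`
— the COMPOSITE printed row ★ P-3 «UNIV-FAMILY» ([Lange2023AbelianVarietiesComplex] Prop. 3.4.1 + Lemma 3.4.7 + Prop. 3.4.8 + Ex. 3.4.5 (7);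
[BirkenhakeLange2004] §8.7–§8.8; [MumfordFogartyKirwan1994] App. to Ch. 7 §A; [SGA1] XII 1.2), consumed at `pelWitnessE_of_line` :690.
HC_CM is proved only modulo the 7 printed citations (2 remaining: hLiu418 = stmt-HodgeConjecture-24832, h413 = stmt-HodgeConjecture-24833)
until rung 0 closes; this workfile (ED. 2) contains no `sorry`: `stub_UNIVFAM_closed` is a closed term over ★ Literature only — whether and
when that changes the books is the LEAD's and the registrar's word, not this file's.

WHAT P-3 SAYS (★ `SiegelUniversalFamilyUniformisation.lean` :109–:186).  INPUTS: a Siegel fine moduli scheme `𝓜` (★ (F), PROVED in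
`Theorems/HCCMUnconditionalSiegelFineModuliDebtCloser` — representability [Lan2013 Thm. 1.4.1.11 ∕ Cor. 7.2.3.9], [MFK94 Thm. 7.9] is NOT on this
socket's path: it is BOUND, not concluded), a piece `(c, S_c, ι_c, unif_c)` of `𝓜 ⊗ ℂ` with the (U2+) clauses and the (U3) junction of ★ (U)
(PROVED, `Theorems/HCCMUnconditionalSiegelDebtClosers`), a smooth complex variety `ψ : T → S_c`, analytifications `MT`, `MA` of `T` and of
the total space of `P_T := 𝓜.univ ×_𝓜 T`, an open `U ⊆ MT` with a holomorphic lift `s` of `ψ^an` through `unif_c`.  CONCLUSION: a relative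
exponential chart (★ `IsRelExpChartOn`) of `MA → MT` over `U` whose period family is the TAUTOLOGICAL `t ↦ Π_{s t}` (★ `siegelPeriodMap`),
(G) whose fibre maps are additive analytifications of the fibres, and (ADM) which ARE the admissible ★ `SiegelAdelicMarking`s by
`[J(s t), r]` (`γ = 1`, `Ψ = Π_{s t}`, torus map = chart fibre map) for every principal representative `r` of `c`.

THE LINE (dedup ×3 with LA7-p01 (g0) ∕ LA7-p02 (g0) censuses 2026-09-02T01:58Z–02:01Z; L-DEAL v1 §L7).  P-3 = P-1 + ALIGNMENT + GLUING:
* `stub_RELEXP`  — ★ P-1 `relativeExponentialUniformisation` BY NAME (named fact, [DeligneHodgeII1971] §4.4 (4.4.2); [Lange2023] Prop. 3.4.1):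
  a relative exponential chart of `(P_T.A)^an → T^an` near every point, with SOME holomorphic period family `Φ₀` and (G).  The printed
  residue of this skeleton: the composite row P-3 is traded for the one-sentence row P-1 (same count, honest).
* `stub_ADMNF`   — POINTWISE ADMISSIBLE PACKAGES IN NORMAL FORM: at every `t ∈ U` and every principal representative `r` of `c`, the fibre
  triple of `P_T` at `φT t` carries an (ADM)-package `(m, Θ, Λ)` by `[J(s t), r]` with `m.γ = 1`, `m.Ψ = Π_{s t}` ((U3∃) at `s t` + transport
  along ★ `IsBaseChangeVia` (★ RD-T3 `SiegelAdmissiblePackageAlongPullbacks`) + ★ `SiegelAdelicMarkingRebaseToUnitBasis`).  [M]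
* `stub_FLAT`    — NORMALISE AT `t₀` AND PROPAGATE («`c₁(λ)` is a flat section of `R²f_*ℤ`», [BirkenhakeLange2004] §8.7 Lemma 8.7.1 setting;
  [Lange2023] proof of Prop. 3.4.8): given the P-1 chart `(Φ₀, ex₀)` near `t₀ ∈ U` and the packages of `stub_ADMNF`, there are an open
  `V' ∋ t₀`, `V' ⊆ U`, a RE-FRAMED chart `(Φ₁, ex₁)` on `V'` (constant change of frame: ★ `RelativeExponentialChartFibreComparison` at `t₀`)
  and `Z : MT → 𝔥_g` with `Z t₀ = s t₀` such that AT EVERY `t ∈ V'` the chart fibre map of `ex₁` IS an (ADM)-package torus map by `[J(Z t), r]`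
  with `γ = 1` and `Ψ = Φ₁ t` — i.e. the symplectic type-`δ` reading of `P.pol` and the level readings through `r` are CONSTANT along the
  continuous chart frame.  The mathematical heart of the line; NOT pinned by complex structure + level-`N` continuity alone (LA7-p01 (g0)
  finding 02:01:28Z: unipotent automorphisms `≡ 1 mod N` of unpolarised fibres).  [L]
* `stub_ALIGN`   — RIEMANN RELATIONS + RE-FRAMING ([Lange2023] Lemma 3.4.7 ∕ Thm. 3.1.2; [BirkenhakeLange2004] Lemma 8.8.1): from `stub_FLAT`'s
  output, `C_t := Φ₁ t ∘ Π_{Z t}⁻¹` is ℂ-linear (marking axiom `Ψ_J`) and `t ↦ Z t`, `t ↦ C_t` are holomorphic; re-framing by `C_t` gives a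
  chart `(Φ₂ = Π_Z, ex₂ (t, z) := ex₁ (t, C_t z))` on `V'` with (C)(G)(ADM at `Z`).  [M]
* `stub_MATCH`   — `Z = s` NEAR `t₀` ([Lange2023] Prop. 3.4.8 «universality» ∕ unique lifting through the unramified covering
  `𝔥_g → Γ_δ(N)\𝔥_g`, `N ≥ 3`): (ADM at `Z t`) and `stub_ADMNF` at `s t` on the SAME fibre + ★ class uniqueness
  (`SiegelAdmissibleClassUnique` ∕ `…TwoReps`) give `s t = M_t • Z t`, `M_t ∈ Γ_δ(N)`; `M_{t₀} = 1` (★ `SiegelPrincipalLevelFree`) and local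
  constancy (continuity + ★ `SiegelUpperHalfSpaceDiscontinuousGroups` ∕ `SiegelUpperHalfSpaceLevelCovering`) give an open `V'' ∋ t₀` with the
  four P-3 conjuncts AT `s`.  [M]
* `stub_GLUE`    — UNIQUENESS GLUING over `U` ([Lange2023] Ex. 3.4.5 (7); ★ `SiegelAdelicMarking.toFun_eq_toFun_of_lifts`
  (`SiegelAdmissibleMarkingUniqueTorus`) + injectivity of `φA` ∕ `fibrePointToLeft`: two local P-3 charts agree pointwise on overlaps;
  ★ `IsRelExpChartOn` is local on the base; the global `Φ` off `U` by ★ `siegelPeriodEquiv` (LA7-p02 (g0) helper TAUT-PERIOD)).  [S∕M]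
HEAD `stub_UNIVFAM_of_organs : RELEXP → ADMNF → FLAT → ALIGN → MATCH → GLUE → siegelUniversalFamilyUniformisation` — PROVED below
(intro the P-3 binders; `GLUE` reduces to local charts at every `t₀ ∈ U`; P-1 at `(T, d, P.A, g, P.relDim, MT, φT, MA, φA)` and `t₀`;
`FLAT` → `ALIGN` → `MATCH`).  Every organ O2–O6 is stated BY VALUE over P-3's binder prefix :110–:158 VERBATIM (same names, same order), so an
organ payer's ★ file head is the organ's `def` body token for token and the leaf closes `stub_X := ★head`.

Upstream (all ★, via the (D)-layer import — β layering, LEAD «M-63»: this leaf imports NO E-line theorem, so the E-line (E) may import it and set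
`theorem stub_UNIVFAM : … := StubUNIVFAM.stub_UNIVFAM_closed` BY NAME without a cycle): ★ P-3 `siegelUniversalFamilyUniformisation`, ★ P-1 `relativeExponentialUniformisation`, ★ `IsRelExpChartOn`,
★ `SiegelAdelicMarking`, ★ `IsAdmissibleAt`, ★ `SiegelFineModuliScheme`, ★ `PolarizedAbelianSchemeWithLevel.baseChange`.  No new definition
besides the five organ `Prop`s; no instance; no axiom.  ED. 2: NO `sorry` — organ O1 `stub_RELEXP` (★ P-1, formerly the printed residue of door (E)) is PAID BY NAME by ★ p849362 `relativeExponentialUniformisation_of_exists_relExpFlow` applied to ★ p849279 `exists_relExpFlow` (the L8-PREP closer + road B, 13 ★ Literature landings of 2026-09-02); O2 `stub_ADMNF` ∕ O3 `stub_FLAT` ∕ O4 `stub_ALIGN` ∕ O5 `stub_MATCH` ∕ O6 `stub_GLUE` are CLOSED in-line over ★ p847727 ∕ ★ {p847957, p848159, p848424, p848162, p848386} ∕ ★ p847835 ∕ ★ p847965 ∕ ★ p847935.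

References: [Lange2023AbelianVarietiesComplex] H. Lange, *Abelian Varieties over the Complex Numbers* (2023) §3.4 pp. 186–191;
[BirkenhakeLange2004] §8.7–§8.8 pp. 229–234; [DeligneHodgeII1971] P. Deligne, *Théorie de Hodge II*, Publ. IHÉS 40 (1971) §4.4 (4.4.2);
[MumfordFogartyKirwan1994] App. to Ch. 7 §A pp. 234–235; [SGA1] Exp. XII 1.2; [Lan2013] K.-W. Lan, *Arithmetic compactifications of
PEL-type Shimura varieties* (2013) Thm. 1.4.1.11, Cor. 7.2.3.9 (bound as `𝓜`, ★ (F)).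
-/

set_option autoImplicit false
set_option linter.dupNamespace false   -- ns `…HodgeConjecture.HodgeConjecture…` (BOX L7 #1 note (h))

noncomputable section

open CategoryTheory CategoryTheory.Limits AlgebraicGeometry Matrix Topology
open scoped Manifold ContDiff Matrix.Norms.Elementwise
open Literature.AlgebraicGeometry
open Literature.AlgebraicGeometry.Motives (SchemeOver ComplexPoints AlgPoints specOver AbelianVariety CartierDivisor)
open Literature.AlgebraicGeometry.AbelianSchemes (PolarizedAbelianSchemeWithLevel AbelianSchemeOver)
open Literature.AlgebraicGeometry.ModuliOfAbelianVarieties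
open Literature.AlgebraicGeometry.ModuliOfAbelianVarieties.SiegelModuli (jOfSiegel)
open Literature.Geometry.Kaehler (ComplexTorus)
open Literature.Geometry.Kaehler.ComplexTorus (cover)
open Literature.Geometry.ComplexAnalytic (IsRelExpChartOn totalOver basePoint relativeExponentialUniformisation)
open Literature.NumberTheory.Transcendental (IsAnalytification)
open Literature.NumberTheory.Automorphic (siegelUpperHalfSpace)

namespace Summit.HodgeConjecture.HodgeConjecture.Cruxes.HLiu418.StubUNIVFAM

/-! ## The organ statements (by value over P-3's binder prefix) -/

/-- **Organ O2 `ADMNF` — pointwise admissible packages in NORMAL FORM along the lift.**  Under P-3's binders: for every principal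
representative `r` of `c` and every `t ∈ U`, the fibre triple of `P := 𝓜.univ ×_𝓜 T` at `φT t` carries `(m, Θ, Λ)` with the three
★ `IsAdmissibleAt` conjuncts read at `φT t`, `m.γ = 1` and `m.Ψ = Π_{s t}` (= P-3's (ADM) block minus its last conjunct).
[cite: Milne2005ShimuraVarieties, §6 Thm. 6.11 p. 74] [cite: Lange2023AbelianVarietiesComplex, §3.4 Prop. 3.4.8 pp. 190–191] -/
def ADMNF : Prop :=
  ∀ (g N : ℕ) (δ : Fin g → ℕ) (_hg : 0 < g) (hδ : IsPolarizationType δ) (_hN : 3 ≤ N) (𝓜 : SiegelFineModuliScheme g N δ)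
    -- a piece of `𝓜 ⊗ ℂ` with its uniformisation, satisfying the (U2+) clauses of ★ `siegelModuli_complexUniformisation` (P-3 :110–:121 verbatim)
    (c : (ZMod N)ˣ) (Sc : SchemeOver ℂ) (ιc : Sc ⟶ (Motives.baseChange ℚ ℂ).obj 𝓜.M)
    (unif : Matrix (Fin g) (Fin g) ℂ → ComplexPoints Sc)
    (_ : ContinuousOn unif (siegelUpperHalfSpace g)) (_ : IsOpenMap ((siegelUpperHalfSpace g).restrict unif))
    (_ : Set.SurjOn unif (siegelUpperHalfSpace g) Set.univ)
    (_ : ∀ Z ∈ siegelUpperHalfSpace g, ∀ Z' ∈ siegelUpperHalfSpace g,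
      unif Z = unif Z' ↔ ∃ M ∈ siegelLevelGroup δ N, ∃ C : (Fin g → ℂ) ≃ₗ[ℂ] (Fin g → ℂ),
        ∀ v : Fin g ⊕ Fin g → ℝ, C (siegelPeriodMap δ Z v) = siegelPeriodMap δ Z' (intAct M v))
    (_ : ∀ (V : Sc.left.affineOpens) (f : Sc.left.presheaf.obj (Opposite.op (↑V : Sc.left.Opens))),
      DifferentiableOn ℂ (fun Z ↦ AlgPoints.evalOrZero (↑V : Sc.left.Opens) f (unif Z))
        (siegelUpperHalfSpace g ∩ unif ⁻¹' {P | P.pt ∈ (↑V : Sc.left.Opens)}))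
    -- the (U3) junction for this piece (P-3 :123–:140 verbatim)
    (_ : ∀ (u : finAdeleQˣ) (r : gspFinAdelic δ),
      (∀ v, Valued.v ((u : finAdeleQ) v) = 1) →
      (u : finAdeleQ) - ((c : ZMod N).val : ℕ) ∈ levelIdeal N →
      r ∈ principalLevelSubgroup δ 1 →
      IsMultiplier (typeFormOver δ finAdeleQ) (r : GL (Fin g ⊕ Fin g) finAdeleQ) u →
      ((r : GL (Fin g ⊕ Fin g) finAdeleQ) : Matrix (Fin g ⊕ Fin g) (Fin g ⊕ Fin g) finAdeleQ) =
        Matrix.fromBlocks 1 0 0 ((u : finAdeleQ) • (1 : Matrix (Fin g) (Fin g) finAdeleQ)) →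
      ∀ (Z : Matrix (Fin g) (Fin g) ℂ) (hZ : Z ∈ siegelUpperHalfSpace g),
        haveI : IsLocallyNoetherian (specOver ℚ ℂ).left :=
          inferInstanceAs (IsLocallyNoetherian (Spec (CommRingCat.of ℂ)))
        (∃ (P' : PolarizedAbelianSchemeWithLevel g N δ (specOver ℚ ℂ).left)
            (G : P'.A.X.left ⟶ 𝓜.univ.A.X.left) (Ĝ : P'.D.hat.X.left ⟶ 𝓜.univ.D.hat.X.left),
            P'.IsBaseChangeVia 𝓜.univ
                ((AlgPoints.baseChangeEquiv (algebraMap ℚ ℂ) 𝓜.M).symm (AlgPoints.map ιc (unif Z))).left G Ĝ ∧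
            IsAdmissibleAt hδ r Z hZ P') ∧
        (∀ (P' : PolarizedAbelianSchemeWithLevel g N δ (specOver ℚ ℂ).left), IsAdmissibleAt hδ r Z hZ P' →
            AlgPoints.map ιc (unif Z)
              = AlgPoints.baseChangeEquiv (algebraMap ℚ ℂ) 𝓜.M (𝓜.classifyingMap (specOver ℚ ℂ) P')))
    -- a smooth complex variety over the piece and the pulled-back universal triple (P-3 :142–:158 verbatim)
    (T : SchemeOver ℂ) (d : ℕ) [LocallyOfFiniteType T.hom] [IsSeparated T.hom] [SmoothOfRelativeDimension d T.hom] (ψ : T ⟶ Sc)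
    (MT : Type) [TopologicalSpace MT] [ChartedSpace (Fin d → ℂ) MT] [IsManifold 𝓘(ℂ, Fin d → ℂ) ω MT]
    (φT : MT → ComplexPoints T) (hT : IsAnalytification (Fin d → ℂ) T d φT)
    (MA : Type) [TopologicalSpace MA] [ChartedSpace (Fin (d + g) → ℂ) MA] [IsManifold 𝓘(ℂ, Fin (d + g) → ℂ) ω MA]
    (φA : MA → ComplexPoints (totalOver T
      (𝓜.univ.baseChange (ψ.left ≫ ιc.left ≫ pullback.fst 𝓜.M.hom (Spec.map (CommRingCat.ofHom (algebraMap ℚ ℂ))))).A))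
    (_ : IsAnalytification (Fin (d + g) → ℂ) (totalOver T
      (𝓜.univ.baseChange (ψ.left ≫ ιc.left ≫ pullback.fst 𝓜.M.hom (Spec.map (CommRingCat.ofHom (algebraMap ℚ ℂ))))).A) (d + g) φA)
    (U : Set MT) (_ : IsOpen U) (s : MT → Matrix (Fin g) (Fin g) ℂ) (hs : ∀ t ∈ U, s t ∈ siegelUpperHalfSpace g)
    (_ : ∀ i j, MDifferentiableOn 𝓘(ℂ, Fin d → ℂ) 𝓘(ℂ, ℂ) (fun t => s t i j) U)
    (_ : ∀ t ∈ U, unif (s t) = AlgPoints.map ψ (φT t)),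
  letI P := 𝓜.univ.baseChange (ψ.left ≫ ιc.left ≫ pullback.fst 𝓜.M.hom (Spec.map (CommRingCat.ofHom (algebraMap ℚ ℂ))))
  (∀ (u : finAdeleQˣ) (r : gspFinAdelic δ),
    (∀ v, Valued.v ((u : finAdeleQ) v) = 1) →
    (u : finAdeleQ) - ((c : ZMod N).val : ℕ) ∈ levelIdeal N →
    r ∈ principalLevelSubgroup δ 1 →
    IsMultiplier (typeFormOver δ finAdeleQ) (r : GL (Fin g ⊕ Fin g) finAdeleQ) u →
    ((r : GL (Fin g ⊕ Fin g) finAdeleQ) : Matrix (Fin g ⊕ Fin g) (Fin g ⊕ Fin g) finAdeleQ) =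
      Matrix.fromBlocks 1 0 0 ((u : finAdeleQ) • (1 : Matrix (Fin g) (Fin g) finAdeleQ)) →
    ∀ (t : MT) (ht : t ∈ U),
      ∃ (m : SiegelAdelicMarking ⟨jOfSiegel δ (s t), SiegelComplexRecordSystem.jOfSiegel_mem_C0pm hδ.1 (hs t ht)⟩ r
            (P.A.fibre (φT t).left).toAbelianVariety)
        (Θ : CartierDivisor (P.A.fibre (φT t).left).toAbelianVariety.X.left)
        (Λ : P.level.SymplecticLift (φT t).left Θ δ),
        Θ.IsAmple ∧ P.A.IsLambdaOfAt (φT t).left P.D P.pol.lam Θ ∧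
        (∀ ⦃M : ℕ⦄, N ∣ M → M ≠ 0 → ∀ (x : Fin g ⊕ Fin g → ZMod M) (v : Fin g ⊕ Fin g → ℚ),
          AdelicCongr ((r⁻¹ : gspFinAdelic δ) : GL (Fin g ⊕ Fin g) finAdeleQ) 1 v (fun i => ((x i).val : ℚ) / M) →
            ((Λ.lift M (Multiplicative.ofAdd x)) : (P.A.fibre (φT t).left).toAbelianVariety.Points ℂ) = m.r v) ∧
        m.γ = 1 ∧ (∀ v : Fin g ⊕ Fin g → ℝ, m.Ψ v = siegelPeriodMap δ (s t) v))

/-- **Organ O3 `FLAT` — normalise a relative exponential chart at `t₀` and PROPAGATE admissibility along its frame.**  Under P-3's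
binders: given `t₀ ∈ U`, a relative exponential chart `(Φ₀, ex₀)` of `MA → MT` on some `U₀ ∋ t₀` with (G), and the packages of `ADMNF`,
there are an open `V' ∋ t₀`, `V' ⊆ U`, a chart `(Φ₁, ex₁)` on `V'` with (G), and `Z : MT → Matrix` with `Z t ∈ 𝔥_g` on `V'` and
`Z t₀ = s t₀`, such that at every `t ∈ V'` and for every principal representative `r` of `c` the chart fibre map of `ex₁` IS the torus map
of an (ADM)-package by `[J(Z t), r]` with `γ = 1` and `Ψ = Φ₁ t` («the first Chern class of the polarisation is a flat section»: the
type-`δ` symplectic reading and the level readings are constant along the continuous chart frame).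
[cite: BirkenhakeLange2004, §8.7 Lemma 8.7.1 pp. 229–231] [cite: Lange2023AbelianVarietiesComplex, §3.4 Prop. 3.4.8 pp. 190–191]
[cite: DeligneHodgeII1971, §4.4 (4.4.2)–(4.4.3) pp. 50–51] -/
def FLAT : Prop :=
  ∀ (g N : ℕ) (δ : Fin g → ℕ) (_hg : 0 < g) (hδ : IsPolarizationType δ) (_hN : 3 ≤ N) (𝓜 : SiegelFineModuliScheme g N δ)
    -- a piece of `𝓜 ⊗ ℂ` with its uniformisation, satisfying the (U2+) clauses of ★ `siegelModuli_complexUniformisation` (P-3 :110–:121 verbatim)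
    (c : (ZMod N)ˣ) (Sc : SchemeOver ℂ) (ιc : Sc ⟶ (Motives.baseChange ℚ ℂ).obj 𝓜.M)
    (unif : Matrix (Fin g) (Fin g) ℂ → ComplexPoints Sc)
    (_ : ContinuousOn unif (siegelUpperHalfSpace g)) (_ : IsOpenMap ((siegelUpperHalfSpace g).restrict unif))
    (_ : Set.SurjOn unif (siegelUpperHalfSpace g) Set.univ)
    (_ : ∀ Z ∈ siegelUpperHalfSpace g, ∀ Z' ∈ siegelUpperHalfSpace g,
      unif Z = unif Z' ↔ ∃ M ∈ siegelLevelGroup δ N, ∃ C : (Fin g → ℂ) ≃ₗ[ℂ] (Fin g → ℂ),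
        ∀ v : Fin g ⊕ Fin g → ℝ, C (siegelPeriodMap δ Z v) = siegelPeriodMap δ Z' (intAct M v))
    (_ : ∀ (V : Sc.left.affineOpens) (f : Sc.left.presheaf.obj (Opposite.op (↑V : Sc.left.Opens))),
      DifferentiableOn ℂ (fun Z ↦ AlgPoints.evalOrZero (↑V : Sc.left.Opens) f (unif Z))
        (siegelUpperHalfSpace g ∩ unif ⁻¹' {P | P.pt ∈ (↑V : Sc.left.Opens)}))
    -- the (U3) junction for this piece (P-3 :123–:140 verbatim)
    (_ : ∀ (u : finAdeleQˣ) (r : gspFinAdelic δ),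
      (∀ v, Valued.v ((u : finAdeleQ) v) = 1) →
      (u : finAdeleQ) - ((c : ZMod N).val : ℕ) ∈ levelIdeal N →
      r ∈ principalLevelSubgroup δ 1 →
      IsMultiplier (typeFormOver δ finAdeleQ) (r : GL (Fin g ⊕ Fin g) finAdeleQ) u →
      ((r : GL (Fin g ⊕ Fin g) finAdeleQ) : Matrix (Fin g ⊕ Fin g) (Fin g ⊕ Fin g) finAdeleQ) =
        Matrix.fromBlocks 1 0 0 ((u : finAdeleQ) • (1 : Matrix (Fin g) (Fin g) finAdeleQ)) →
      ∀ (Z : Matrix (Fin g) (Fin g) ℂ) (hZ : Z ∈ siegelUpperHalfSpace g),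
        haveI : IsLocallyNoetherian (specOver ℚ ℂ).left :=
          inferInstanceAs (IsLocallyNoetherian (Spec (CommRingCat.of ℂ)))
        (∃ (P' : PolarizedAbelianSchemeWithLevel g N δ (specOver ℚ ℂ).left)
            (G : P'.A.X.left ⟶ 𝓜.univ.A.X.left) (Ĝ : P'.D.hat.X.left ⟶ 𝓜.univ.D.hat.X.left),
            P'.IsBaseChangeVia 𝓜.univ
                ((AlgPoints.baseChangeEquiv (algebraMap ℚ ℂ) 𝓜.M).symm (AlgPoints.map ιc (unif Z))).left G Ĝ ∧
            IsAdmissibleAt hδ r Z hZ P') ∧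
        (∀ (P' : PolarizedAbelianSchemeWithLevel g N δ (specOver ℚ ℂ).left), IsAdmissibleAt hδ r Z hZ P' →
            AlgPoints.map ιc (unif Z)
              = AlgPoints.baseChangeEquiv (algebraMap ℚ ℂ) 𝓜.M (𝓜.classifyingMap (specOver ℚ ℂ) P')))
    -- a smooth complex variety over the piece and the pulled-back universal triple (P-3 :142–:158 verbatim)
    (T : SchemeOver ℂ) (d : ℕ) [LocallyOfFiniteType T.hom] [IsSeparated T.hom] [SmoothOfRelativeDimension d T.hom] (ψ : T ⟶ Sc)
    (MT : Type) [TopologicalSpace MT] [ChartedSpace (Fin d → ℂ) MT] [IsManifold 𝓘(ℂ, Fin d → ℂ) ω MT]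
    (φT : MT → ComplexPoints T) (hT : IsAnalytification (Fin d → ℂ) T d φT)
    (MA : Type) [TopologicalSpace MA] [ChartedSpace (Fin (d + g) → ℂ) MA] [IsManifold 𝓘(ℂ, Fin (d + g) → ℂ) ω MA]
    (φA : MA → ComplexPoints (totalOver T
      (𝓜.univ.baseChange (ψ.left ≫ ιc.left ≫ pullback.fst 𝓜.M.hom (Spec.map (CommRingCat.ofHom (algebraMap ℚ ℂ))))).A))
    (_ : IsAnalytification (Fin (d + g) → ℂ) (totalOver T
      (𝓜.univ.baseChange (ψ.left ≫ ιc.left ≫ pullback.fst 𝓜.M.hom (Spec.map (CommRingCat.ofHom (algebraMap ℚ ℂ))))).A) (d + g) φA)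
    (U : Set MT) (_ : IsOpen U) (s : MT → Matrix (Fin g) (Fin g) ℂ) (hs : ∀ t ∈ U, s t ∈ siegelUpperHalfSpace g)
    (_ : ∀ i j, MDifferentiableOn 𝓘(ℂ, Fin d → ℂ) 𝓘(ℂ, ℂ) (fun t => s t i j) U)
    (_ : ∀ t ∈ U, unif (s t) = AlgPoints.map ψ (φT t))
    -- organ binders: the point, the raw chart with (G), the normal-form packages along `U`
    (t₀ : MT) (_ : t₀ ∈ U) (U₀ : Set MT) (Φ₀ : MT → ((Fin g ⊕ Fin g → ℝ) ≃L[ℝ] (Fin g → ℂ))) (ex₀ : MT × (Fin g → ℂ) → MA)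
    (_ : t₀ ∈ U₀),
  letI P := 𝓜.univ.baseChange (ψ.left ≫ ιc.left ≫ pullback.fst 𝓜.M.hom (Spec.map (CommRingCat.ofHom (algebraMap ℚ ℂ))))
  IsRelExpChartOn (Fin d → ℂ) (Fin (d + g) → ℂ) (basePoint hT P.A φA) U₀ Φ₀ ex₀ →
  (∀ t ∈ U₀, ∃ φt : ComplexTorus (Φ₀ t) → (P.A.fibre (φT t).left).toAbelianVariety.Points ℂ,
    IsAnalytification (Fin g → ℂ) (P.A.fibre (φT t).left).toAbelianVariety.X g φt ∧
    (∀ x y, φt (x + y) = φt x * φt y) ∧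
    ∀ z : Fin g → ℂ, (φA (ex₀ (t, z))).left = P.A.fibrePointToLeft (φT t).left (φt (cover (Φ₀ t) z))) →
  (∀ (u : finAdeleQˣ) (r : gspFinAdelic δ),
    (∀ v, Valued.v ((u : finAdeleQ) v) = 1) →
    (u : finAdeleQ) - ((c : ZMod N).val : ℕ) ∈ levelIdeal N →
    r ∈ principalLevelSubgroup δ 1 →
    IsMultiplier (typeFormOver δ finAdeleQ) (r : GL (Fin g ⊕ Fin g) finAdeleQ) u →
    ((r : GL (Fin g ⊕ Fin g) finAdeleQ) : Matrix (Fin g ⊕ Fin g) (Fin g ⊕ Fin g) finAdeleQ) =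
      Matrix.fromBlocks 1 0 0 ((u : finAdeleQ) • (1 : Matrix (Fin g) (Fin g) finAdeleQ)) →
    ∀ (t : MT) (ht : t ∈ U),
      ∃ (m : SiegelAdelicMarking ⟨jOfSiegel δ (s t), SiegelComplexRecordSystem.jOfSiegel_mem_C0pm hδ.1 (hs t ht)⟩ r
            (P.A.fibre (φT t).left).toAbelianVariety)
        (Θ : CartierDivisor (P.A.fibre (φT t).left).toAbelianVariety.X.left)
        (Λ : P.level.SymplecticLift (φT t).left Θ δ),
        Θ.IsAmple ∧ P.A.IsLambdaOfAt (φT t).left P.D P.pol.lam Θ ∧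
        (∀ ⦃M : ℕ⦄, N ∣ M → M ≠ 0 → ∀ (x : Fin g ⊕ Fin g → ZMod M) (v : Fin g ⊕ Fin g → ℚ),
          AdelicCongr ((r⁻¹ : gspFinAdelic δ) : GL (Fin g ⊕ Fin g) finAdeleQ) 1 v (fun i => ((x i).val : ℚ) / M) →
            ((Λ.lift M (Multiplicative.ofAdd x)) : (P.A.fibre (φT t).left).toAbelianVariety.Points ℂ) = m.r v) ∧
        m.γ = 1 ∧ (∀ v : Fin g ⊕ Fin g → ℝ, m.Ψ v = siegelPeriodMap δ (s t) v)) →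
  ∃ (V' : Set MT) (_ : IsOpen V') (_ : t₀ ∈ V') (_ : V' ⊆ U)
    (Φ₁ : MT → ((Fin g ⊕ Fin g → ℝ) ≃L[ℝ] (Fin g → ℂ))) (ex₁ : MT × (Fin g → ℂ) → MA)
    (Z : MT → Matrix (Fin g) (Fin g) ℂ) (hZ : ∀ t ∈ V', Z t ∈ siegelUpperHalfSpace g),
    Z t₀ = s t₀ ∧
    IsRelExpChartOn (Fin d → ℂ) (Fin (d + g) → ℂ) (basePoint hT P.A φA) V' Φ₁ ex₁ ∧
    (∀ t ∈ V', ∃ φt : ComplexTorus (Φ₁ t) → (P.A.fibre (φT t).left).toAbelianVariety.Points ℂ,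
      IsAnalytification (Fin g → ℂ) (P.A.fibre (φT t).left).toAbelianVariety.X g φt ∧
      (∀ x y, φt (x + y) = φt x * φt y) ∧
      ∀ z : Fin g → ℂ, (φA (ex₁ (t, z))).left = P.A.fibrePointToLeft (φT t).left (φt (cover (Φ₁ t) z))) ∧
    (∀ (u : finAdeleQˣ) (r : gspFinAdelic δ),
      (∀ v, Valued.v ((u : finAdeleQ) v) = 1) →
      (u : finAdeleQ) - ((c : ZMod N).val : ℕ) ∈ levelIdeal N →
      r ∈ principalLevelSubgroup δ 1 →
      IsMultiplier (typeFormOver δ finAdeleQ) (r : GL (Fin g ⊕ Fin g) finAdeleQ) u →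
      ((r : GL (Fin g ⊕ Fin g) finAdeleQ) : Matrix (Fin g ⊕ Fin g) (Fin g ⊕ Fin g) finAdeleQ) =
        Matrix.fromBlocks 1 0 0 ((u : finAdeleQ) • (1 : Matrix (Fin g) (Fin g) finAdeleQ)) →
      ∀ (t : MT) (ht : t ∈ V'),
        ∃ (m : SiegelAdelicMarking ⟨jOfSiegel δ (Z t), SiegelComplexRecordSystem.jOfSiegel_mem_C0pm hδ.1 (hZ t ht)⟩ r
              (P.A.fibre (φT t).left).toAbelianVariety)
          (Θ : CartierDivisor (P.A.fibre (φT t).left).toAbelianVariety.X.left)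
          (Λ : P.level.SymplecticLift (φT t).left Θ δ),
          Θ.IsAmple ∧ P.A.IsLambdaOfAt (φT t).left P.D P.pol.lam Θ ∧
          (∀ ⦃M : ℕ⦄, N ∣ M → M ≠ 0 → ∀ (x : Fin g ⊕ Fin g → ZMod M) (v : Fin g ⊕ Fin g → ℚ),
            AdelicCongr ((r⁻¹ : gspFinAdelic δ) : GL (Fin g ⊕ Fin g) finAdeleQ) 1 v (fun i => ((x i).val : ℚ) / M) →
              ((Λ.lift M (Multiplicative.ofAdd x)) : (P.A.fibre (φT t).left).toAbelianVariety.Points ℂ) = m.r v) ∧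
          m.γ = 1 ∧ (∀ v : Fin g ⊕ Fin g → ℝ, m.Ψ v = Φ₁ t v) ∧
          ∀ z : Fin g → ℂ, P.A.fibrePointToLeft (φT t).left (m.toFun (cover m.Ψ z)) = (φA (ex₁ (t, z))).left)

/-- **Organ O4 `ALIGN` — Riemann relations and re-framing to the tautological periods `Π_Z`.**  Under P-3's binders: from `FLAT`'s output
on `V'` (chart `(Φ₁, ex₁)` with (G) whose fibre maps are (ADM)-package torus maps by `[J(Z t), r]` with `Ψ = Φ₁ t`), the matrix family `Z` is
holomorphic on `V'` and there is a chart `(Φ₂, ex₂)` on `V'` with `Φ₂ t = Π_{Z t}`, (C), (G) and (ADM at `Z t`) in P-3's normal form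
(`γ = 1`, `Ψ = Π_{Z t}`, torus map = chart fibre map) — `C_t := Φ₁ t ∘ Π_{Z t}⁻¹` is ℂ-linear by the marking axiom `Ψ_J` and holomorphic in
`t`, `ex₂ (t, z) := ex₁ (t, C_t z)`.
[cite: Lange2023AbelianVarietiesComplex, §3.4 Lemma 3.4.7 p. 189 + §3.1 Thm. 3.1.2 p. 163] [cite: BirkenhakeLange2004, §8.8 Lemma 8.8.1 pp. 232–233] -/
def ALIGN : Prop :=
  ∀ (g N : ℕ) (δ : Fin g → ℕ) (_hg : 0 < g) (hδ : IsPolarizationType δ) (_hN : 3 ≤ N) (𝓜 : SiegelFineModuliScheme g N δ)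
    -- a piece of `𝓜 ⊗ ℂ` with its uniformisation, satisfying the (U2+) clauses of ★ `siegelModuli_complexUniformisation` (P-3 :110–:121 verbatim)
    (c : (ZMod N)ˣ) (Sc : SchemeOver ℂ) (ιc : Sc ⟶ (Motives.baseChange ℚ ℂ).obj 𝓜.M)
    (unif : Matrix (Fin g) (Fin g) ℂ → ComplexPoints Sc)
    (_ : ContinuousOn unif (siegelUpperHalfSpace g)) (_ : IsOpenMap ((siegelUpperHalfSpace g).restrict unif))
    (_ : Set.SurjOn unif (siegelUpperHalfSpace g) Set.univ)
    (_ : ∀ Z ∈ siegelUpperHalfSpace g, ∀ Z' ∈ siegelUpperHalfSpace g,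
      unif Z = unif Z' ↔ ∃ M ∈ siegelLevelGroup δ N, ∃ C : (Fin g → ℂ) ≃ₗ[ℂ] (Fin g → ℂ),
        ∀ v : Fin g ⊕ Fin g → ℝ, C (siegelPeriodMap δ Z v) = siegelPeriodMap δ Z' (intAct M v))
    (_ : ∀ (V : Sc.left.affineOpens) (f : Sc.left.presheaf.obj (Opposite.op (↑V : Sc.left.Opens))),
      DifferentiableOn ℂ (fun Z ↦ AlgPoints.evalOrZero (↑V : Sc.left.Opens) f (unif Z))
        (siegelUpperHalfSpace g ∩ unif ⁻¹' {P | P.pt ∈ (↑V : Sc.left.Opens)}))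
    -- the (U3) junction for this piece (P-3 :123–:140 verbatim)
    (_ : ∀ (u : finAdeleQˣ) (r : gspFinAdelic δ),
      (∀ v, Valued.v ((u : finAdeleQ) v) = 1) →
      (u : finAdeleQ) - ((c : ZMod N).val : ℕ) ∈ levelIdeal N →
      r ∈ principalLevelSubgroup δ 1 →
      IsMultiplier (typeFormOver δ finAdeleQ) (r : GL (Fin g ⊕ Fin g) finAdeleQ) u →
      ((r : GL (Fin g ⊕ Fin g) finAdeleQ) : Matrix (Fin g ⊕ Fin g) (Fin g ⊕ Fin g) finAdeleQ) =
        Matrix.fromBlocks 1 0 0 ((u : finAdeleQ) • (1 : Matrix (Fin g) (Fin g) finAdeleQ)) →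
      ∀ (Z : Matrix (Fin g) (Fin g) ℂ) (hZ : Z ∈ siegelUpperHalfSpace g),
        haveI : IsLocallyNoetherian (specOver ℚ ℂ).left :=
          inferInstanceAs (IsLocallyNoetherian (Spec (CommRingCat.of ℂ)))
        (∃ (P' : PolarizedAbelianSchemeWithLevel g N δ (specOver ℚ ℂ).left)
            (G : P'.A.X.left ⟶ 𝓜.univ.A.X.left) (Ĝ : P'.D.hat.X.left ⟶ 𝓜.univ.D.hat.X.left),
            P'.IsBaseChangeVia 𝓜.univ
                ((AlgPoints.baseChangeEquiv (algebraMap ℚ ℂ) 𝓜.M).symm (AlgPoints.map ιc (unif Z))).left G Ĝ ∧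
            IsAdmissibleAt hδ r Z hZ P') ∧
        (∀ (P' : PolarizedAbelianSchemeWithLevel g N δ (specOver ℚ ℂ).left), IsAdmissibleAt hδ r Z hZ P' →
            AlgPoints.map ιc (unif Z)
              = AlgPoints.baseChangeEquiv (algebraMap ℚ ℂ) 𝓜.M (𝓜.classifyingMap (specOver ℚ ℂ) P')))
    -- a smooth complex variety over the piece and the pulled-back universal triple (P-3 :142–:158 verbatim)
    (T : SchemeOver ℂ) (d : ℕ) [LocallyOfFiniteType T.hom] [IsSeparated T.hom] [SmoothOfRelativeDimension d T.hom] (ψ : T ⟶ Sc)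
    (MT : Type) [TopologicalSpace MT] [ChartedSpace (Fin d → ℂ) MT] [IsManifold 𝓘(ℂ, Fin d → ℂ) ω MT]
    (φT : MT → ComplexPoints T) (hT : IsAnalytification (Fin d → ℂ) T d φT)
    (MA : Type) [TopologicalSpace MA] [ChartedSpace (Fin (d + g) → ℂ) MA] [IsManifold 𝓘(ℂ, Fin (d + g) → ℂ) ω MA]
    (φA : MA → ComplexPoints (totalOver T
      (𝓜.univ.baseChange (ψ.left ≫ ιc.left ≫ pullback.fst 𝓜.M.hom (Spec.map (CommRingCat.ofHom (algebraMap ℚ ℂ))))).A))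
    (_ : IsAnalytification (Fin (d + g) → ℂ) (totalOver T
      (𝓜.univ.baseChange (ψ.left ≫ ιc.left ≫ pullback.fst 𝓜.M.hom (Spec.map (CommRingCat.ofHom (algebraMap ℚ ℂ))))).A) (d + g) φA)
    (U : Set MT) (_ : IsOpen U) (s : MT → Matrix (Fin g) (Fin g) ℂ) (hs : ∀ t ∈ U, s t ∈ siegelUpperHalfSpace g)
    (_ : ∀ i j, MDifferentiableOn 𝓘(ℂ, Fin d → ℂ) 𝓘(ℂ, ℂ) (fun t => s t i j) U)
    (_ : ∀ t ∈ U, unif (s t) = AlgPoints.map ψ (φT t))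
    -- organ binders: `FLAT`'s output
    (V' : Set MT) (_ : IsOpen V') (_ : V' ⊆ U)
    (Φ₁ : MT → ((Fin g ⊕ Fin g → ℝ) ≃L[ℝ] (Fin g → ℂ))) (ex₁ : MT × (Fin g → ℂ) → MA)
    (Z : MT → Matrix (Fin g) (Fin g) ℂ) (hZ : ∀ t ∈ V', Z t ∈ siegelUpperHalfSpace g),
  letI P := 𝓜.univ.baseChange (ψ.left ≫ ιc.left ≫ pullback.fst 𝓜.M.hom (Spec.map (CommRingCat.ofHom (algebraMap ℚ ℂ))))
  IsRelExpChartOn (Fin d → ℂ) (Fin (d + g) → ℂ) (basePoint hT P.A φA) V' Φ₁ ex₁ →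
  (∀ t ∈ V', ∃ φt : ComplexTorus (Φ₁ t) → (P.A.fibre (φT t).left).toAbelianVariety.Points ℂ,
    IsAnalytification (Fin g → ℂ) (P.A.fibre (φT t).left).toAbelianVariety.X g φt ∧
    (∀ x y, φt (x + y) = φt x * φt y) ∧
    ∀ z : Fin g → ℂ, (φA (ex₁ (t, z))).left = P.A.fibrePointToLeft (φT t).left (φt (cover (Φ₁ t) z))) →
  (∀ (u : finAdeleQˣ) (r : gspFinAdelic δ),
    (∀ v, Valued.v ((u : finAdeleQ) v) = 1) →
    (u : finAdeleQ) - ((c : ZMod N).val : ℕ) ∈ levelIdeal N →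
    r ∈ principalLevelSubgroup δ 1 →
    IsMultiplier (typeFormOver δ finAdeleQ) (r : GL (Fin g ⊕ Fin g) finAdeleQ) u →
    ((r : GL (Fin g ⊕ Fin g) finAdeleQ) : Matrix (Fin g ⊕ Fin g) (Fin g ⊕ Fin g) finAdeleQ) =
      Matrix.fromBlocks 1 0 0 ((u : finAdeleQ) • (1 : Matrix (Fin g) (Fin g) finAdeleQ)) →
    ∀ (t : MT) (ht : t ∈ V'),
      ∃ (m : SiegelAdelicMarking ⟨jOfSiegel δ (Z t), SiegelComplexRecordSystem.jOfSiegel_mem_C0pm hδ.1 (hZ t ht)⟩ r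
            (P.A.fibre (φT t).left).toAbelianVariety)
        (Θ : CartierDivisor (P.A.fibre (φT t).left).toAbelianVariety.X.left)
        (Λ : P.level.SymplecticLift (φT t).left Θ δ),
        Θ.IsAmple ∧ P.A.IsLambdaOfAt (φT t).left P.D P.pol.lam Θ ∧
        (∀ ⦃M : ℕ⦄, N ∣ M → M ≠ 0 → ∀ (x : Fin g ⊕ Fin g → ZMod M) (v : Fin g ⊕ Fin g → ℚ),
          AdelicCongr ((r⁻¹ : gspFinAdelic δ) : GL (Fin g ⊕ Fin g) finAdeleQ) 1 v (fun i => ((x i).val : ℚ) / M) →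
            ((Λ.lift M (Multiplicative.ofAdd x)) : (P.A.fibre (φT t).left).toAbelianVariety.Points ℂ) = m.r v) ∧
        m.γ = 1 ∧ (∀ v : Fin g ⊕ Fin g → ℝ, m.Ψ v = Φ₁ t v) ∧
        ∀ z : Fin g → ℂ, P.A.fibrePointToLeft (φT t).left (m.toFun (cover m.Ψ z)) = (φA (ex₁ (t, z))).left) →
  ∃ (Φ₂ : MT → ((Fin g ⊕ Fin g → ℝ) ≃L[ℝ] (Fin g → ℂ))) (ex₂ : MT × (Fin g → ℂ) → MA),
    (∀ i j, MDifferentiableOn 𝓘(ℂ, Fin d → ℂ) 𝓘(ℂ, ℂ) (fun t => Z t i j) V') ∧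
    (∀ t ∈ V', ∀ v : Fin g ⊕ Fin g → ℝ, Φ₂ t v = siegelPeriodMap δ (Z t) v) ∧
    IsRelExpChartOn (Fin d → ℂ) (Fin (d + g) → ℂ) (basePoint hT P.A φA) V' Φ₂ ex₂ ∧
    (∀ t ∈ V', ∃ φt : ComplexTorus (Φ₂ t) → (P.A.fibre (φT t).left).toAbelianVariety.Points ℂ,
      IsAnalytification (Fin g → ℂ) (P.A.fibre (φT t).left).toAbelianVariety.X g φt ∧
      (∀ x y, φt (x + y) = φt x * φt y) ∧
      ∀ z : Fin g → ℂ, (φA (ex₂ (t, z))).left = P.A.fibrePointToLeft (φT t).left (φt (cover (Φ₂ t) z))) ∧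
    (∀ (u : finAdeleQˣ) (r : gspFinAdelic δ),
      (∀ v, Valued.v ((u : finAdeleQ) v) = 1) →
      (u : finAdeleQ) - ((c : ZMod N).val : ℕ) ∈ levelIdeal N →
      r ∈ principalLevelSubgroup δ 1 →
      IsMultiplier (typeFormOver δ finAdeleQ) (r : GL (Fin g ⊕ Fin g) finAdeleQ) u →
      ((r : GL (Fin g ⊕ Fin g) finAdeleQ) : Matrix (Fin g ⊕ Fin g) (Fin g ⊕ Fin g) finAdeleQ) =
        Matrix.fromBlocks 1 0 0 ((u : finAdeleQ) • (1 : Matrix (Fin g) (Fin g) finAdeleQ)) →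
      ∀ (t : MT) (ht : t ∈ V'),
        ∃ (m : SiegelAdelicMarking ⟨jOfSiegel δ (Z t), SiegelComplexRecordSystem.jOfSiegel_mem_C0pm hδ.1 (hZ t ht)⟩ r
              (P.A.fibre (φT t).left).toAbelianVariety)
          (Θ : CartierDivisor (P.A.fibre (φT t).left).toAbelianVariety.X.left)
          (Λ : P.level.SymplecticLift (φT t).left Θ δ),
          Θ.IsAmple ∧ P.A.IsLambdaOfAt (φT t).left P.D P.pol.lam Θ ∧
          (∀ ⦃M : ℕ⦄, N ∣ M → M ≠ 0 → ∀ (x : Fin g ⊕ Fin g → ZMod M) (v : Fin g ⊕ Fin g → ℚ),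
            AdelicCongr ((r⁻¹ : gspFinAdelic δ) : GL (Fin g ⊕ Fin g) finAdeleQ) 1 v (fun i => ((x i).val : ℚ) / M) →
              ((Λ.lift M (Multiplicative.ofAdd x)) : (P.A.fibre (φT t).left).toAbelianVariety.Points ℂ) = m.r v) ∧
          m.γ = 1 ∧ (∀ v : Fin g ⊕ Fin g → ℝ, m.Ψ v = siegelPeriodMap δ (Z t) v) ∧
          ∀ z : Fin g → ℂ, P.A.fibrePointToLeft (φT t).left (m.toFun (cover m.Ψ z)) = (φA (ex₂ (t, z))).left)

/-- **Organ O5 `MATCH` — the period matrix of an admissibly marked chart IS the lift: `Z = s` near `t₀`.**  Under P-3's binders: a chart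
`(Φ₂, ex₂)` on an open `V' ∋ t₀`, `V' ⊆ U`, in P-3's normal form at a holomorphic `Z : V' → 𝔥_g` with `Z t₀ = s t₀`, together with the
packages of `ADMNF` at `s`, restricts on some open `V'' ∋ t₀`, `V'' ⊆ U`, to a chart with the FOUR P-3 conjuncts AT `s` (class uniqueness
`s t = M_t • Z t`, `M_t ∈ Γ_δ(N)`, `M_{t₀} = 1` by freeness (`N ≥ 3`), local constancy by proper discontinuity ∕ unique lifting through `unif_c`).
[cite: Lange2023AbelianVarietiesComplex, §3.4 Prop. 3.4.8 + Ex. 3.4.5 (7) pp. 190–191] [cite: BirkenhakeLange2004, §8.8 pp. 232–234]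
[cite: Milne2005ShimuraVarieties, §6 Thm. 6.11 p. 74] -/
def MATCH : Prop :=
  ∀ (g N : ℕ) (δ : Fin g → ℕ) (_hg : 0 < g) (hδ : IsPolarizationType δ) (_hN : 3 ≤ N) (𝓜 : SiegelFineModuliScheme g N δ)
    -- a piece of `𝓜 ⊗ ℂ` with its uniformisation, satisfying the (U2+) clauses of ★ `siegelModuli_complexUniformisation` (P-3 :110–:121 verbatim)
    (c : (ZMod N)ˣ) (Sc : SchemeOver ℂ) (ιc : Sc ⟶ (Motives.baseChange ℚ ℂ).obj 𝓜.M)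
    (unif : Matrix (Fin g) (Fin g) ℂ → ComplexPoints Sc)
    (_ : ContinuousOn unif (siegelUpperHalfSpace g)) (_ : IsOpenMap ((siegelUpperHalfSpace g).restrict unif))
    (_ : Set.SurjOn unif (siegelUpperHalfSpace g) Set.univ)
    (_ : ∀ Z ∈ siegelUpperHalfSpace g, ∀ Z' ∈ siegelUpperHalfSpace g,
      unif Z = unif Z' ↔ ∃ M ∈ siegelLevelGroup δ N, ∃ C : (Fin g → ℂ) ≃ₗ[ℂ] (Fin g → ℂ),
        ∀ v : Fin g ⊕ Fin g → ℝ, C (siegelPeriodMap δ Z v) = siegelPeriodMap δ Z' (intAct M v))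
    (_ : ∀ (V : Sc.left.affineOpens) (f : Sc.left.presheaf.obj (Opposite.op (↑V : Sc.left.Opens))),
      DifferentiableOn ℂ (fun Z ↦ AlgPoints.evalOrZero (↑V : Sc.left.Opens) f (unif Z))
        (siegelUpperHalfSpace g ∩ unif ⁻¹' {P | P.pt ∈ (↑V : Sc.left.Opens)}))
    -- the (U3) junction for this piece (P-3 :123–:140 verbatim)
    (_ : ∀ (u : finAdeleQˣ) (r : gspFinAdelic δ),
      (∀ v, Valued.v ((u : finAdeleQ) v) = 1) →
      (u : finAdeleQ) - ((c : ZMod N).val : ℕ) ∈ levelIdeal N →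
      r ∈ principalLevelSubgroup δ 1 →
      IsMultiplier (typeFormOver δ finAdeleQ) (r : GL (Fin g ⊕ Fin g) finAdeleQ) u →
      ((r : GL (Fin g ⊕ Fin g) finAdeleQ) : Matrix (Fin g ⊕ Fin g) (Fin g ⊕ Fin g) finAdeleQ) =
        Matrix.fromBlocks 1 0 0 ((u : finAdeleQ) • (1 : Matrix (Fin g) (Fin g) finAdeleQ)) →
      ∀ (Z : Matrix (Fin g) (Fin g) ℂ) (hZ : Z ∈ siegelUpperHalfSpace g),
        haveI : IsLocallyNoetherian (specOver ℚ ℂ).left :=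
          inferInstanceAs (IsLocallyNoetherian (Spec (CommRingCat.of ℂ)))
        (∃ (P' : PolarizedAbelianSchemeWithLevel g N δ (specOver ℚ ℂ).left)
            (G : P'.A.X.left ⟶ 𝓜.univ.A.X.left) (Ĝ : P'.D.hat.X.left ⟶ 𝓜.univ.D.hat.X.left),
            P'.IsBaseChangeVia 𝓜.univ
                ((AlgPoints.baseChangeEquiv (algebraMap ℚ ℂ) 𝓜.M).symm (AlgPoints.map ιc (unif Z))).left G Ĝ ∧
            IsAdmissibleAt hδ r Z hZ P') ∧
        (∀ (P' : PolarizedAbelianSchemeWithLevel g N δ (specOver ℚ ℂ).left), IsAdmissibleAt hδ r Z hZ P' →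
            AlgPoints.map ιc (unif Z)
              = AlgPoints.baseChangeEquiv (algebraMap ℚ ℂ) 𝓜.M (𝓜.classifyingMap (specOver ℚ ℂ) P')))
    -- a smooth complex variety over the piece and the pulled-back universal triple (P-3 :142–:158 verbatim)
    (T : SchemeOver ℂ) (d : ℕ) [LocallyOfFiniteType T.hom] [IsSeparated T.hom] [SmoothOfRelativeDimension d T.hom] (ψ : T ⟶ Sc)
    (MT : Type) [TopologicalSpace MT] [ChartedSpace (Fin d → ℂ) MT] [IsManifold 𝓘(ℂ, Fin d → ℂ) ω MT]
    (φT : MT → ComplexPoints T) (hT : IsAnalytification (Fin d → ℂ) T d φT)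
    (MA : Type) [TopologicalSpace MA] [ChartedSpace (Fin (d + g) → ℂ) MA] [IsManifold 𝓘(ℂ, Fin (d + g) → ℂ) ω MA]
    (φA : MA → ComplexPoints (totalOver T
      (𝓜.univ.baseChange (ψ.left ≫ ιc.left ≫ pullback.fst 𝓜.M.hom (Spec.map (CommRingCat.ofHom (algebraMap ℚ ℂ))))).A))
    (_ : IsAnalytification (Fin (d + g) → ℂ) (totalOver T
      (𝓜.univ.baseChange (ψ.left ≫ ιc.left ≫ pullback.fst 𝓜.M.hom (Spec.map (CommRingCat.ofHom (algebraMap ℚ ℂ))))).A) (d + g) φA)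
    (U : Set MT) (_ : IsOpen U) (s : MT → Matrix (Fin g) (Fin g) ℂ) (hs : ∀ t ∈ U, s t ∈ siegelUpperHalfSpace g)
    (_ : ∀ i j, MDifferentiableOn 𝓘(ℂ, Fin d → ℂ) 𝓘(ℂ, ℂ) (fun t => s t i j) U)
    (_ : ∀ t ∈ U, unif (s t) = AlgPoints.map ψ (φT t))
    -- organ binders: the point, `ALIGN`'s output, the normal-form packages along `U`
    (t₀ : MT) (V' : Set MT) (_ : IsOpen V') (_ : t₀ ∈ V') (_ : V' ⊆ U)
    (Z : MT → Matrix (Fin g) (Fin g) ℂ) (hZ : ∀ t ∈ V', Z t ∈ siegelUpperHalfSpace g)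
    (_ : ∀ i j, MDifferentiableOn 𝓘(ℂ, Fin d → ℂ) 𝓘(ℂ, ℂ) (fun t => Z t i j) V') (_ : Z t₀ = s t₀)
    (Φ₂ : MT → ((Fin g ⊕ Fin g → ℝ) ≃L[ℝ] (Fin g → ℂ))) (ex₂ : MT × (Fin g → ℂ) → MA),
  letI P := 𝓜.univ.baseChange (ψ.left ≫ ιc.left ≫ pullback.fst 𝓜.M.hom (Spec.map (CommRingCat.ofHom (algebraMap ℚ ℂ))))
  (∀ t ∈ V', ∀ v : Fin g ⊕ Fin g → ℝ, Φ₂ t v = siegelPeriodMap δ (Z t) v) →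
  IsRelExpChartOn (Fin d → ℂ) (Fin (d + g) → ℂ) (basePoint hT P.A φA) V' Φ₂ ex₂ →
  (∀ t ∈ V', ∃ φt : ComplexTorus (Φ₂ t) → (P.A.fibre (φT t).left).toAbelianVariety.Points ℂ,
    IsAnalytification (Fin g → ℂ) (P.A.fibre (φT t).left).toAbelianVariety.X g φt ∧
    (∀ x y, φt (x + y) = φt x * φt y) ∧
    ∀ z : Fin g → ℂ, (φA (ex₂ (t, z))).left = P.A.fibrePointToLeft (φT t).left (φt (cover (Φ₂ t) z))) →
  (∀ (u : finAdeleQˣ) (r : gspFinAdelic δ),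
    (∀ v, Valued.v ((u : finAdeleQ) v) = 1) →
    (u : finAdeleQ) - ((c : ZMod N).val : ℕ) ∈ levelIdeal N →
    r ∈ principalLevelSubgroup δ 1 →
    IsMultiplier (typeFormOver δ finAdeleQ) (r : GL (Fin g ⊕ Fin g) finAdeleQ) u →
    ((r : GL (Fin g ⊕ Fin g) finAdeleQ) : Matrix (Fin g ⊕ Fin g) (Fin g ⊕ Fin g) finAdeleQ) =
      Matrix.fromBlocks 1 0 0 ((u : finAdeleQ) • (1 : Matrix (Fin g) (Fin g) finAdeleQ)) →
    ∀ (t : MT) (ht : t ∈ V'),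
      ∃ (m : SiegelAdelicMarking ⟨jOfSiegel δ (Z t), SiegelComplexRecordSystem.jOfSiegel_mem_C0pm hδ.1 (hZ t ht)⟩ r
            (P.A.fibre (φT t).left).toAbelianVariety)
        (Θ : CartierDivisor (P.A.fibre (φT t).left).toAbelianVariety.X.left)
        (Λ : P.level.SymplecticLift (φT t).left Θ δ),
        Θ.IsAmple ∧ P.A.IsLambdaOfAt (φT t).left P.D P.pol.lam Θ ∧
        (∀ ⦃M : ℕ⦄, N ∣ M → M ≠ 0 → ∀ (x : Fin g ⊕ Fin g → ZMod M) (v : Fin g ⊕ Fin g → ℚ),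
          AdelicCongr ((r⁻¹ : gspFinAdelic δ) : GL (Fin g ⊕ Fin g) finAdeleQ) 1 v (fun i => ((x i).val : ℚ) / M) →
            ((Λ.lift M (Multiplicative.ofAdd x)) : (P.A.fibre (φT t).left).toAbelianVariety.Points ℂ) = m.r v) ∧
        m.γ = 1 ∧ (∀ v : Fin g ⊕ Fin g → ℝ, m.Ψ v = siegelPeriodMap δ (Z t) v) ∧
        ∀ z : Fin g → ℂ, P.A.fibrePointToLeft (φT t).left (m.toFun (cover m.Ψ z)) = (φA (ex₂ (t, z))).left) →
  (∀ (u : finAdeleQˣ) (r : gspFinAdelic δ),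
    (∀ v, Valued.v ((u : finAdeleQ) v) = 1) →
    (u : finAdeleQ) - ((c : ZMod N).val : ℕ) ∈ levelIdeal N →
    r ∈ principalLevelSubgroup δ 1 →
    IsMultiplier (typeFormOver δ finAdeleQ) (r : GL (Fin g ⊕ Fin g) finAdeleQ) u →
    ((r : GL (Fin g ⊕ Fin g) finAdeleQ) : Matrix (Fin g ⊕ Fin g) (Fin g ⊕ Fin g) finAdeleQ) =
      Matrix.fromBlocks 1 0 0 ((u : finAdeleQ) • (1 : Matrix (Fin g) (Fin g) finAdeleQ)) →
    ∀ (t : MT) (ht : t ∈ U),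
      ∃ (m : SiegelAdelicMarking ⟨jOfSiegel δ (s t), SiegelComplexRecordSystem.jOfSiegel_mem_C0pm hδ.1 (hs t ht)⟩ r
            (P.A.fibre (φT t).left).toAbelianVariety)
        (Θ : CartierDivisor (P.A.fibre (φT t).left).toAbelianVariety.X.left)
        (Λ : P.level.SymplecticLift (φT t).left Θ δ),
        Θ.IsAmple ∧ P.A.IsLambdaOfAt (φT t).left P.D P.pol.lam Θ ∧
        (∀ ⦃M : ℕ⦄, N ∣ M → M ≠ 0 → ∀ (x : Fin g ⊕ Fin g → ZMod M) (v : Fin g ⊕ Fin g → ℚ),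
          AdelicCongr ((r⁻¹ : gspFinAdelic δ) : GL (Fin g ⊕ Fin g) finAdeleQ) 1 v (fun i => ((x i).val : ℚ) / M) →
            ((Λ.lift M (Multiplicative.ofAdd x)) : (P.A.fibre (φT t).left).toAbelianVariety.Points ℂ) = m.r v) ∧
        m.γ = 1 ∧ (∀ v : Fin g ⊕ Fin g → ℝ, m.Ψ v = siegelPeriodMap δ (s t) v)) →
  ∃ (V'' : Set MT) (_ : IsOpen V'') (_ : t₀ ∈ V'') (hV''U : V'' ⊆ U)
    (Φ : MT → ((Fin g ⊕ Fin g → ℝ) ≃L[ℝ] (Fin g → ℂ))) (ex : MT × (Fin g → ℂ) → MA),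
    (∀ t ∈ V'', ∀ v : Fin g ⊕ Fin g → ℝ, Φ t v = siegelPeriodMap δ (s t) v) ∧
    IsRelExpChartOn (Fin d → ℂ) (Fin (d + g) → ℂ) (basePoint hT P.A φA) V'' Φ ex ∧
    (∀ t ∈ V'', ∃ φt : ComplexTorus (Φ t) → (P.A.fibre (φT t).left).toAbelianVariety.Points ℂ,
      IsAnalytification (Fin g → ℂ) (P.A.fibre (φT t).left).toAbelianVariety.X g φt ∧
      (∀ x y, φt (x + y) = φt x * φt y) ∧
      ∀ z : Fin g → ℂ, (φA (ex (t, z))).left = P.A.fibrePointToLeft (φT t).left (φt (cover (Φ t) z))) ∧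
    (∀ (u : finAdeleQˣ) (r : gspFinAdelic δ),
      (∀ v, Valued.v ((u : finAdeleQ) v) = 1) →
      (u : finAdeleQ) - ((c : ZMod N).val : ℕ) ∈ levelIdeal N →
      r ∈ principalLevelSubgroup δ 1 →
      IsMultiplier (typeFormOver δ finAdeleQ) (r : GL (Fin g ⊕ Fin g) finAdeleQ) u →
      ((r : GL (Fin g ⊕ Fin g) finAdeleQ) : Matrix (Fin g ⊕ Fin g) (Fin g ⊕ Fin g) finAdeleQ) =
        Matrix.fromBlocks 1 0 0 ((u : finAdeleQ) • (1 : Matrix (Fin g) (Fin g) finAdeleQ)) →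
      ∀ (t : MT) (ht : t ∈ V''),
        ∃ (m : SiegelAdelicMarking ⟨jOfSiegel δ (s t), SiegelComplexRecordSystem.jOfSiegel_mem_C0pm hδ.1 (hs t (hV''U ht))⟩ r
              (P.A.fibre (φT t).left).toAbelianVariety)
          (Θ : CartierDivisor (P.A.fibre (φT t).left).toAbelianVariety.X.left)
          (Λ : P.level.SymplecticLift (φT t).left Θ δ),
          Θ.IsAmple ∧ P.A.IsLambdaOfAt (φT t).left P.D P.pol.lam Θ ∧
          (∀ ⦃M : ℕ⦄, N ∣ M → M ≠ 0 → ∀ (x : Fin g ⊕ Fin g → ZMod M) (v : Fin g ⊕ Fin g → ℚ),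
            AdelicCongr ((r⁻¹ : gspFinAdelic δ) : GL (Fin g ⊕ Fin g) finAdeleQ) 1 v (fun i => ((x i).val : ℚ) / M) →
              ((Λ.lift M (Multiplicative.ofAdd x)) : (P.A.fibre (φT t).left).toAbelianVariety.Points ℂ) = m.r v) ∧
          m.γ = 1 ∧ (∀ v : Fin g ⊕ Fin g → ℝ, m.Ψ v = siegelPeriodMap δ (s t) v) ∧
          ∀ z : Fin g → ℂ, P.A.fibrePointToLeft (φT t).left (m.toFun (cover m.Ψ z)) = (φA (ex (t, z))).left)

/-- **Organ O6 `GLUE` — uniqueness gluing of local tautological charts over `U`.**  Under P-3's binders: if every `t₀ ∈ U` has an open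
`V'' ∋ t₀`, `V'' ⊆ U`, carrying a chart with the FOUR P-3 conjuncts at `s`, then `U` carries one (two such charts agree pointwise on
overlaps: their fibre maps are torus maps of admissible markings with the same `(J, r, Ψ)` and matched symplectic lifts —
★ `SiegelAdelicMarking.toFun_eq_toFun_of_lifts` — and `φA`, `fibrePointToLeft` are injective; ★ `IsRelExpChartOn` is local on the base).
[cite: Lange2023AbelianVarietiesComplex, §3.4 Ex. 3.4.5 (7) p. 191] [cite: BirkenhakeLange2004, §8.7 Lemma 8.7.1 p. 230] [cite: Milne2005ShimuraVarieties, §6 Thm. 6.11 p. 74] -/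
def GLUE : Prop :=
  ∀ (g N : ℕ) (δ : Fin g → ℕ) (_hg : 0 < g) (hδ : IsPolarizationType δ) (_hN : 3 ≤ N) (𝓜 : SiegelFineModuliScheme g N δ)
    -- a piece of `𝓜 ⊗ ℂ` with its uniformisation, satisfying the (U2+) clauses of ★ `siegelModuli_complexUniformisation` (P-3 :110–:121 verbatim)
    (c : (ZMod N)ˣ) (Sc : SchemeOver ℂ) (ιc : Sc ⟶ (Motives.baseChange ℚ ℂ).obj 𝓜.M)
    (unif : Matrix (Fin g) (Fin g) ℂ → ComplexPoints Sc)
    (_ : ContinuousOn unif (siegelUpperHalfSpace g)) (_ : IsOpenMap ((siegelUpperHalfSpace g).restrict unif))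
    (_ : Set.SurjOn unif (siegelUpperHalfSpace g) Set.univ)
    (_ : ∀ Z ∈ siegelUpperHalfSpace g, ∀ Z' ∈ siegelUpperHalfSpace g,
      unif Z = unif Z' ↔ ∃ M ∈ siegelLevelGroup δ N, ∃ C : (Fin g → ℂ) ≃ₗ[ℂ] (Fin g → ℂ),
        ∀ v : Fin g ⊕ Fin g → ℝ, C (siegelPeriodMap δ Z v) = siegelPeriodMap δ Z' (intAct M v))
    (_ : ∀ (V : Sc.left.affineOpens) (f : Sc.left.presheaf.obj (Opposite.op (↑V : Sc.left.Opens))),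
      DifferentiableOn ℂ (fun Z ↦ AlgPoints.evalOrZero (↑V : Sc.left.Opens) f (unif Z))
        (siegelUpperHalfSpace g ∩ unif ⁻¹' {P | P.pt ∈ (↑V : Sc.left.Opens)}))
    -- the (U3) junction for this piece (P-3 :123–:140 verbatim)
    (_ : ∀ (u : finAdeleQˣ) (r : gspFinAdelic δ),
      (∀ v, Valued.v ((u : finAdeleQ) v) = 1) →
      (u : finAdeleQ) - ((c : ZMod N).val : ℕ) ∈ levelIdeal N →
      r ∈ principalLevelSubgroup δ 1 →
      IsMultiplier (typeFormOver δ finAdeleQ) (r : GL (Fin g ⊕ Fin g) finAdeleQ) u →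
      ((r : GL (Fin g ⊕ Fin g) finAdeleQ) : Matrix (Fin g ⊕ Fin g) (Fin g ⊕ Fin g) finAdeleQ) =
        Matrix.fromBlocks 1 0 0 ((u : finAdeleQ) • (1 : Matrix (Fin g) (Fin g) finAdeleQ)) →
      ∀ (Z : Matrix (Fin g) (Fin g) ℂ) (hZ : Z ∈ siegelUpperHalfSpace g),
        haveI : IsLocallyNoetherian (specOver ℚ ℂ).left :=
          inferInstanceAs (IsLocallyNoetherian (Spec (CommRingCat.of ℂ)))
        (∃ (P' : PolarizedAbelianSchemeWithLevel g N δ (specOver ℚ ℂ).left)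
            (G : P'.A.X.left ⟶ 𝓜.univ.A.X.left) (Ĝ : P'.D.hat.X.left ⟶ 𝓜.univ.D.hat.X.left),
            P'.IsBaseChangeVia 𝓜.univ
                ((AlgPoints.baseChangeEquiv (algebraMap ℚ ℂ) 𝓜.M).symm (AlgPoints.map ιc (unif Z))).left G Ĝ ∧
            IsAdmissibleAt hδ r Z hZ P') ∧
        (∀ (P' : PolarizedAbelianSchemeWithLevel g N δ (specOver ℚ ℂ).left), IsAdmissibleAt hδ r Z hZ P' →
            AlgPoints.map ιc (unif Z)
              = AlgPoints.baseChangeEquiv (algebraMap ℚ ℂ) 𝓜.M (𝓜.classifyingMap (specOver ℚ ℂ) P')))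
    -- a smooth complex variety over the piece and the pulled-back universal triple (P-3 :142–:158 verbatim)
    (T : SchemeOver ℂ) (d : ℕ) [LocallyOfFiniteType T.hom] [IsSeparated T.hom] [SmoothOfRelativeDimension d T.hom] (ψ : T ⟶ Sc)
    (MT : Type) [TopologicalSpace MT] [ChartedSpace (Fin d → ℂ) MT] [IsManifold 𝓘(ℂ, Fin d → ℂ) ω MT]
    (φT : MT → ComplexPoints T) (hT : IsAnalytification (Fin d → ℂ) T d φT)
    (MA : Type) [TopologicalSpace MA] [ChartedSpace (Fin (d + g) → ℂ) MA] [IsManifold 𝓘(ℂ, Fin (d + g) → ℂ) ω MA]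
    (φA : MA → ComplexPoints (totalOver T
      (𝓜.univ.baseChange (ψ.left ≫ ιc.left ≫ pullback.fst 𝓜.M.hom (Spec.map (CommRingCat.ofHom (algebraMap ℚ ℂ))))).A))
    (_ : IsAnalytification (Fin (d + g) → ℂ) (totalOver T
      (𝓜.univ.baseChange (ψ.left ≫ ιc.left ≫ pullback.fst 𝓜.M.hom (Spec.map (CommRingCat.ofHom (algebraMap ℚ ℂ))))).A) (d + g) φA)
    (U : Set MT) (_ : IsOpen U) (s : MT → Matrix (Fin g) (Fin g) ℂ) (hs : ∀ t ∈ U, s t ∈ siegelUpperHalfSpace g)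
    (_ : ∀ i j, MDifferentiableOn 𝓘(ℂ, Fin d → ℂ) 𝓘(ℂ, ℂ) (fun t => s t i j) U)
    (_ : ∀ t ∈ U, unif (s t) = AlgPoints.map ψ (φT t)),
  letI P := 𝓜.univ.baseChange (ψ.left ≫ ιc.left ≫ pullback.fst 𝓜.M.hom (Spec.map (CommRingCat.ofHom (algebraMap ℚ ℂ))))
  (∀ t₀ ∈ U, ∃ (V'' : Set MT) (_ : IsOpen V'') (_ : t₀ ∈ V'') (hV''U : V'' ⊆ U)
      (Φ : MT → ((Fin g ⊕ Fin g → ℝ) ≃L[ℝ] (Fin g → ℂ))) (ex : MT × (Fin g → ℂ) → MA),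
      (∀ t ∈ V'', ∀ v : Fin g ⊕ Fin g → ℝ, Φ t v = siegelPeriodMap δ (s t) v) ∧
      IsRelExpChartOn (Fin d → ℂ) (Fin (d + g) → ℂ) (basePoint hT P.A φA) V'' Φ ex ∧
      (∀ t ∈ V'', ∃ φt : ComplexTorus (Φ t) → (P.A.fibre (φT t).left).toAbelianVariety.Points ℂ,
        IsAnalytification (Fin g → ℂ) (P.A.fibre (φT t).left).toAbelianVariety.X g φt ∧
        (∀ x y, φt (x + y) = φt x * φt y) ∧
        ∀ z : Fin g → ℂ, (φA (ex (t, z))).left = P.A.fibrePointToLeft (φT t).left (φt (cover (Φ t) z))) ∧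
      (∀ (u : finAdeleQˣ) (r : gspFinAdelic δ),
        (∀ v, Valued.v ((u : finAdeleQ) v) = 1) →
        (u : finAdeleQ) - ((c : ZMod N).val : ℕ) ∈ levelIdeal N →
        r ∈ principalLevelSubgroup δ 1 →
        IsMultiplier (typeFormOver δ finAdeleQ) (r : GL (Fin g ⊕ Fin g) finAdeleQ) u →
        ((r : GL (Fin g ⊕ Fin g) finAdeleQ) : Matrix (Fin g ⊕ Fin g) (Fin g ⊕ Fin g) finAdeleQ) =
          Matrix.fromBlocks 1 0 0 ((u : finAdeleQ) • (1 : Matrix (Fin g) (Fin g) finAdeleQ)) →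
        ∀ (t : MT) (ht : t ∈ V''),
          ∃ (m : SiegelAdelicMarking ⟨jOfSiegel δ (s t), SiegelComplexRecordSystem.jOfSiegel_mem_C0pm hδ.1 (hs t (hV''U ht))⟩ r
                (P.A.fibre (φT t).left).toAbelianVariety)
            (Θ : CartierDivisor (P.A.fibre (φT t).left).toAbelianVariety.X.left)
            (Λ : P.level.SymplecticLift (φT t).left Θ δ),
            Θ.IsAmple ∧ P.A.IsLambdaOfAt (φT t).left P.D P.pol.lam Θ ∧
            (∀ ⦃M : ℕ⦄, N ∣ M → M ≠ 0 → ∀ (x : Fin g ⊕ Fin g → ZMod M) (v : Fin g ⊕ Fin g → ℚ),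
              AdelicCongr ((r⁻¹ : gspFinAdelic δ) : GL (Fin g ⊕ Fin g) finAdeleQ) 1 v (fun i => ((x i).val : ℚ) / M) →
                ((Λ.lift M (Multiplicative.ofAdd x)) : (P.A.fibre (φT t).left).toAbelianVariety.Points ℂ) = m.r v) ∧
            m.γ = 1 ∧ (∀ v : Fin g ⊕ Fin g → ℝ, m.Ψ v = siegelPeriodMap δ (s t) v) ∧
            ∀ z : Fin g → ℂ, P.A.fibrePointToLeft (φT t).left (m.toFun (cover m.Ψ z)) = (φA (ex (t, z))).left)) →
  ∃ (Φ : MT → ((Fin g ⊕ Fin g → ℝ) ≃L[ℝ] (Fin g → ℂ))) (ex : MT × (Fin g → ℂ) → MA),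
    (∀ t ∈ U, ∀ v : Fin g ⊕ Fin g → ℝ, Φ t v = siegelPeriodMap δ (s t) v) ∧
    IsRelExpChartOn (Fin d → ℂ) (Fin (d + g) → ℂ) (basePoint hT P.A φA) U Φ ex ∧
    (∀ t ∈ U, ∃ φt : ComplexTorus (Φ t) → (P.A.fibre (φT t).left).toAbelianVariety.Points ℂ,
      IsAnalytification (Fin g → ℂ) (P.A.fibre (φT t).left).toAbelianVariety.X g φt ∧
      (∀ x y, φt (x + y) = φt x * φt y) ∧
      ∀ z : Fin g → ℂ, (φA (ex (t, z))).left = P.A.fibrePointToLeft (φT t).left (φt (cover (Φ t) z))) ∧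
    (∀ (u : finAdeleQˣ) (r : gspFinAdelic δ),
      (∀ v, Valued.v ((u : finAdeleQ) v) = 1) →
      (u : finAdeleQ) - ((c : ZMod N).val : ℕ) ∈ levelIdeal N →
      r ∈ principalLevelSubgroup δ 1 →
      IsMultiplier (typeFormOver δ finAdeleQ) (r : GL (Fin g ⊕ Fin g) finAdeleQ) u →
      ((r : GL (Fin g ⊕ Fin g) finAdeleQ) : Matrix (Fin g ⊕ Fin g) (Fin g ⊕ Fin g) finAdeleQ) =
        Matrix.fromBlocks 1 0 0 ((u : finAdeleQ) • (1 : Matrix (Fin g) (Fin g) finAdeleQ)) →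
      ∀ (t : MT) (ht : t ∈ U),
        ∃ (m : SiegelAdelicMarking ⟨jOfSiegel δ (s t), SiegelComplexRecordSystem.jOfSiegel_mem_C0pm hδ.1 (hs t ht)⟩ r
              (P.A.fibre (φT t).left).toAbelianVariety)
          (Θ : CartierDivisor (P.A.fibre (φT t).left).toAbelianVariety.X.left)
          (Λ : P.level.SymplecticLift (φT t).left Θ δ),
          Θ.IsAmple ∧ P.A.IsLambdaOfAt (φT t).left P.D P.pol.lam Θ ∧
          (∀ ⦃M : ℕ⦄, N ∣ M → M ≠ 0 → ∀ (x : Fin g ⊕ Fin g → ZMod M) (v : Fin g ⊕ Fin g → ℚ),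
            AdelicCongr ((r⁻¹ : gspFinAdelic δ) : GL (Fin g ⊕ Fin g) finAdeleQ) 1 v (fun i => ((x i).val : ℚ) / M) →
              ((Λ.lift M (Multiplicative.ofAdd x)) : (P.A.fibre (φT t).left).toAbelianVariety.Points ℂ) = m.r v) ∧
          m.γ = 1 ∧ (∀ v : Fin g ⊕ Fin g → ℝ, m.Ψ v = siegelPeriodMap δ (s t) v) ∧
          ∀ z : Fin g → ℂ, P.A.fibrePointToLeft (φT t).left (m.toFun (cover m.Ψ z)) = (φA (ex (t, z))).left)

/-! ## The organs (ED. 2: all PAID — no `sorry`) -/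

/-- **Organ O1 `stub_RELEXP` — PAID (ED. 2)** = ★ P-1 (U6-a) `relativeExponentialUniformisation`, now a THEOREM of the tree: ★ p849362
`relativeExponentialUniformisation_of_exists_relExpFlow` (L8-PREP closer, LA1-plan (g2): kernel lattice (L1) ★ p849017, holomorphic periods (L2)
★ p849083, chart FILE 3, fibre group law O4 ★ p849209) applied to ★ p849279 `exists_relExpFlow` (L8-PREP road B, LA7-plan (g2): doubling datum
B1 ★ p849240, Kœnigs linearising chart B2 ★ p849248 over ★ O3 p849119, equivariant extension B3 ★ p849077, fibre linearity B4 ★ p849045) — the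
relative exponential uniformisation of an analytified abelian scheme over a smooth complex base (formerly the printed residue of this skeleton).
[cite: DeligneHodgeII1971, §4.4 (4.4.2)–(4.4.3) pp. 50–51] [cite: Lange2023AbelianVarietiesComplex, §3.4 Prop. 3.4.1 p. 186] -/
theorem stub_RELEXP : relativeExponentialUniformisation :=
  Literature.Geometry.ComplexAnalytic.relativeExponentialUniformisation_of_exists_relExpFlow
    Literature.Geometry.ComplexAnalytic.exists_relExpFlow

/-- **Organ O2 — PAID** (LA7-p01 (g0), ★ p847727 `SiegelUniversalFamilyPullbackAdmissibleNormalForm`): the (U3∃) clause of the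
bound junction at `Z := s t` (lift equation `unif (s t) = ψ (φT t)`) transported to the fibre of `P_T` at `φT t` and put in normal form by
★ `exists_admPackage_normalForm_of_junction`. [cite: Milne2005ShimuraVarieties, §6 Thm. 6.11 p. 74] -/
theorem stub_ADMNF : ADMNF := by
  intro g N δ _hg hδ _hN 𝓜 c Sc ιc unif _hu₁ _hu₂ _hu₃ _hu₄ _hu₅ hU3 T d _i₁ _i₂ _i₃ ψ MT _i₄ _i₅ _i₆ φT hT MA _i₇ _i₈ _i₉ φA _hA U _hU
    s hs _hsd hlift u r h₁ h₂ h₃ h₄ h₅ t ht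
  exact exists_admPackage_normalForm_of_junction hδ 𝓜 ιc ψ (φT t) (hlift t ht).symm h₃ (hs t ht)
    (hU3 u r h₁ h₂ h₃ h₄ h₅ (s t) (hs t ht)).1

/-- **Organ O3 `stub_FLAT` — PAID IN-HOUSE (ED. 2)** over ★ FLAT-a NORM₀ p847957 (`SiegelAdelicMarking.exists_normalisedChart`, LA7-p01),
★ FLAT-b(i) p848159 (`levelReading_const`, LA7-p02), ★ FLAT-b(ii) p848424 (`pairingReading_const`, LA7-p02; fibre reading ★ p848216 LA7-p01),
★ FLAT-c p848162 (`exists_framePackage_of_readings`, LA7-p01) and ★ FLAT-d p848386 (`SiegelAdelicMarking.toFun_eq_toFun_of_lifts₂`, LA7-p01):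
NORM₀ at `t₀` with the ADM-NF package through one principal representative `(u₀, r₀)` → a connected chart neighbourhood `V' ∋ t₀` in
`U ∩ U₀` (Mathlib `ChartedSpace.locallyConnectedSpace`) → `Z t := Z_{J(Φ₁ t)}` (★ `SiegelModuli.siegelOfJ`; `Z t₀ = s t₀` by ★
`jMatrix_siegelPeriodEquiv` + ★ `siegelOfJ_jOfSiegel`) → for every `(t, u, r)`: the `t₀`-package through `r` has the chart's torus map
(FLAT-d), its level and Weil-pairing readings are constant along `V'` ((L=), (W=)), so ★ FLAT-c returns the frame package at `t`.
[cite: BirkenhakeLange2004, §8.7 Lemma 8.7.1 pp. 229–231] [cite: Milne2005ShimuraVarieties, §6 Thm. 6.11 pp. 74–75] -/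
theorem stub_FLAT : FLAT := by
  intro g N δ hg hδ hN 𝓜 c Sc ιc unif _hu₁ _hu₂ _hu₃ _hu₄ _hu₅ _hU3 T d _i₁ _i₂ _i₃ ψ MT _i₄ _i₅ _i₆ φT hT MA _i₇ _i₈ _i₉ φA hA U hU
    s hs _hsd _hlift t₀ ht₀ U₀ Φ₀ ex₀ ht₀U₀ hC₀ hG₀ hNF
  let P : PolarizedAbelianSchemeWithLevel g N δ T.left :=
    𝓜.univ.baseChange (ψ.left ≫ ιc.left ≫ pullback.fst 𝓜.M.hom (Spec.map (CommRingCat.ofHom (algebraMap ℚ ℂ))))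
  have hN0 : N ≠ 0 := by omega
  -- commutativity of the abelian scheme `P.A` (for ★ FLAT-d): the smooth base `T` is locally Noetherian
  haveI : IsLocallyNoetherian T.left := LocallyOfFiniteType.isLocallyNoetherian T.hom
  haveI : IsCommMonObj P.A.X := P.A.isCommMonObj_of_isLocallyNoetherian_base
  -- a principal representative `(u₀, r₀)` of the residue `c` and the ADM-NF package at `t₀` through it
  obtain ⟨u₀, r₀, h₁, h₂, h₃, h₄, h₅⟩ := exists_principalRep δ hN0 c
  obtain ⟨m₀, Θ₀, Λ₀, hample₀, hlam₀, htower₀, hγ₀, hΨ₀⟩ := hNF u₀ r₀ h₁ h₂ h₃ h₄ h₅ t₀ ht₀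
  -- NORM₀: re-normalise the raw chart at `t₀` by `m₀`
  obtain ⟨Φ₁, ex₁, hC₁, hG₁, hΦ₁t₀, hjunc₀⟩ := SiegelAdelicMarking.exists_normalisedChart P.A hT φA hC₀ hG₀ ht₀U₀ m₀
  -- a connected open neighbourhood `V'` of `t₀` inside `U ∩ U₀`
  haveI : LocallyConnectedSpace MT := ChartedSpace.locallyConnectedSpace (Fin d → ℂ) MT
  obtain ⟨V', hV'sub, hV'o, ht₀V', hV'conn⟩ :=
    locallyConnectedSpace_iff_subsets_isOpen_isConnected.mp ‹LocallyConnectedSpace MT› t₀ (U ∩ U₀)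
      ((hU.inter hC₀.isOpen).mem_nhds ⟨ht₀, ht₀U₀⟩)
  have hV' : V' ⊆ U := fun x hx => (hV'sub hx).1
  have hV'U₀ : V' ⊆ U₀ := fun x hx => (hV'sub hx).2
  have hV'pre : IsPreconnected V' := hV'conn.isPreconnected
  have hC₁' : IsRelExpChartOn (Fin d → ℂ) (Fin (d + g) → ℂ) (basePoint hT P.A φA) V' Φ₁ ex₁ := hC₁.mono hV'o hV'U₀
  have hG₁' : ∀ t ∈ V', ∃ φt : ComplexTorus (Φ₁ t) → (P.A.fibre (φT t).left).toAbelianVariety.Points ℂ,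
      IsAnalytification (Fin g → ℂ) (P.A.fibre (φT t).left).toAbelianVariety.X g φt ∧
      (∀ x y, φt (x + y) = φt x * φt y) ∧
      ∀ z : Fin g → ℂ, (φA (ex₁ (t, z))).left = P.A.fibrePointToLeft (φT t).left (φt (cover (Φ₁ t) z)) :=
    fun t ht => hG₁ t (hV'U₀ ht)
  have hΨ₀' : ∀ v : Fin g ⊕ Fin g → ℝ, m₀.Ψ v = Φ₁ t₀ v := fun v => by rw [hΦ₁t₀]
  -- KEY: the frame package at every `t ∈ V'` through every principal `(u, r)` (FLAT-c over (L=), (W=), FLAT-d)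
  have key : ∀ (u : finAdeleQˣ) (r : gspFinAdelic δ),
      (∀ v, Valued.v ((u : finAdeleQ) v) = 1) →
      (u : finAdeleQ) - ((c : ZMod N).val : ℕ) ∈ levelIdeal N →
      r ∈ principalLevelSubgroup δ 1 →
      IsMultiplier (typeFormOver δ finAdeleQ) (r : GL (Fin g ⊕ Fin g) finAdeleQ) u →
      ((r : GL (Fin g ⊕ Fin g) finAdeleQ) : Matrix (Fin g ⊕ Fin g) (Fin g ⊕ Fin g) finAdeleQ) =
        Matrix.fromBlocks 1 0 0 ((u : finAdeleQ) • (1 : Matrix (Fin g) (Fin g) finAdeleQ)) →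
      ∀ t ∈ V', ∃ (Z' : Matrix (Fin g) (Fin g) ℂ) (hZ' : Z' ∈ siegelUpperHalfSpace g),
        ComplexTorus.jMatrix (Φ₁ t) = jOfSiegel δ Z' ∧
        ∃ (m : SiegelAdelicMarking ⟨jOfSiegel δ Z', SiegelComplexRecordSystem.jOfSiegel_mem_C0pm hδ.1 hZ'⟩ r
              (P.A.fibre (φT t).left).toAbelianVariety)
          (Θ : CartierDivisor (P.A.fibre (φT t).left).toAbelianVariety.X.left)
          (Λ : P.level.SymplecticLift (φT t).left Θ δ),
          Θ.IsAmple ∧ P.A.IsLambdaOfAt (φT t).left P.D P.pol.lam Θ ∧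
          (∀ ⦃M : ℕ⦄, N ∣ M → M ≠ 0 → ∀ (x : Fin g ⊕ Fin g → ZMod M) (v : Fin g ⊕ Fin g → ℚ),
            AdelicCongr ((r⁻¹ : gspFinAdelic δ) : GL (Fin g ⊕ Fin g) finAdeleQ) 1 v (fun i => ((x i).val : ℚ) / M) →
              ((Λ.lift M (Multiplicative.ofAdd x)) : (P.A.fibre (φT t).left).toAbelianVariety.Points ℂ) = m.r v) ∧
          m.γ = 1 ∧ (∀ v : Fin g ⊕ Fin g → ℝ, m.Ψ v = Φ₁ t v) ∧
          ∀ z : Fin g → ℂ, P.A.fibrePointToLeft (φT t).left (m.toFun (cover m.Ψ z)) = (φA (ex₁ (t, z))).left := by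
    intro u r k₁ k₂ k₃ k₄ k₅ t ht
    -- the ADM-NF packages through `r` at `t₀` and at `t`
    obtain ⟨m₁, Θ₁, Λ₁, hample₁, hlam₁, htower₁, hγ₁, hΨ₁⟩ := hNF u r k₁ k₂ k₃ k₄ k₅ t₀ ht₀
    obtain ⟨_mt, Θt, _Λt, hamplet, hlamt, -, -, -⟩ := hNF u r k₁ k₂ k₃ k₄ k₅ t (hV' ht)
    -- FLAT-d: the torus map of `m₁` is that of `m₀`
    have hΨ₁₀ : ∀ v : Fin g ⊕ Fin g → ℝ, m₁.Ψ v = m₀.Ψ v := fun v => by rw [hΨ₁, hΨ₀]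
    have htor : ∀ x : ComplexTorus m₀.Ψ, m₀.toFun x = m₁.toFun x := fun x =>
      SiegelAdelicMarking.toFun_eq_toFun_of_lifts₂ hg hδ hN h₁ h₂ h₃ h₄ h₅ k₁ k₂ k₃ k₄ k₅ (hs t₀ ht₀) m₀ Λ₀ hlam₀ htower₀
        m₁ Λ₁ hlam₁ htower₁ hγ₀ hγ₁ x
    have hΨeq : m₁.Ψ = m₀.Ψ := by
      ext v i
      rw [hΨ₁₀]
    have hΨ₁' : ∀ v : Fin g ⊕ Fin g → ℝ, m₁.Ψ v = Φ₁ t₀ v := fun v => by rw [hΨ₁₀, hΨ₀']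
    have hjunc₁ : ∀ z : Fin g → ℂ,
        P.A.fibrePointToLeft (φT t₀).left (m₁.toFun (cover m₁.Ψ z)) = (φA (ex₁ (t₀, z))).left := by
      intro z
      rw [hjunc₀ z, hΨeq, ← htor]
    -- FLAT-c at `(t, u, r)`
    obtain ⟨Z', hZ', hj, m, Λ, htower, hγ, hΨ, hjunc⟩ :=
      exists_framePackage_of_readings hδ hg hN0 P φA (hG₁' t ht) k₃ (hs t₀ ht₀) m₁ Θ₁ Λ₁ hample₁ hlam₁ htower₁ hγ₁ hΨ₁'
        hjunc₁ Θt hamplet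
        (RelativeExponentialChartLevelReadings.levelReading_const hN0 P hT φA hA hC₁' hV'pre hG₁' ht₀V' ht)
        (RelativeExponentialChartPairingReadings.pairingReading_const P hT φA hA hC₁' hV'pre hG₁' ht₀V' ht Θ₁ hlam₁ Θt hlamt)
    exact ⟨Z', hZ', hj, m, Θt, Λ, hamplet, hlamt, htower, hγ, hΨ, hjunc⟩
  -- the matrix family `Z t := Z_{J(Φ₁ t)}` (★ `siegelOfJ`), in `𝔥_g` on `V'` and equal to `s` at `t₀`
  have hZeq : ∀ t : MT, ∀ {Z' : Matrix (Fin g) (Fin g) ℂ}, Z' ∈ siegelUpperHalfSpace g →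
      ComplexTorus.jMatrix (Φ₁ t) = jOfSiegel δ Z' → SiegelModuli.siegelOfJ δ (ComplexTorus.jMatrix (Φ₁ t)) = Z' := by
    intro t Z' hZ' hj
    rw [hj, SiegelModuli.siegelOfJ_jOfSiegel hδ.1 hZ']
  have hZf : ∀ t ∈ V', SiegelModuli.siegelOfJ δ (ComplexTorus.jMatrix (Φ₁ t)) ∈ siegelUpperHalfSpace g := by
    intro t ht
    obtain ⟨Z', hZ', hj, -⟩ := key u₀ r₀ h₁ h₂ h₃ h₄ h₅ t ht
    rw [hZeq t hZ' hj]
    exact hZ'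
  have hZ₀ : SiegelModuli.siegelOfJ δ (ComplexTorus.jMatrix (Φ₁ t₀)) = s t₀ := by
    refine hZeq t₀ (hs t₀ ht₀) ?_
    have hΦ : Φ₁ t₀ = siegelPeriodEquiv hδ.1 (hs t₀ ht₀) := by
      rw [hΦ₁t₀]
      ext v i
      rw [hΨ₀, siegelPeriodEquiv_apply]
    rw [hΦ, SiegelModuli.jMatrix_siegelPeriodEquiv]
  refine ⟨V', hV'o, ht₀V', hV', Φ₁, ex₁, fun t => SiegelModuli.siegelOfJ δ (ComplexTorus.jMatrix (Φ₁ t)), hZf, hZ₀, hC₁', hG₁', ?_⟩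
  intro u r k₁ k₂ k₃ k₄ k₅ t ht
  obtain ⟨Z', hZ', hj, m, Θ, Λ, hample, hlam, htower, hγ, hΨ, hjunc⟩ := key u r k₁ k₂ k₃ k₄ k₅ t ht
  have hZt : SiegelModuli.siegelOfJ δ (ComplexTorus.jMatrix (Φ₁ t)) = Z' := hZeq t hZ' hj
  subst hZt
  exact ⟨m, Θ, Λ, hample, hlam, htower, hγ, hΨ, hjunc⟩

/-- **Organ O4 — PAID** (LA7-p01 (g0), ★ p847835 `SiegelUniversalFamilyChartAlign`): the `J(Z t)`-linearity of the frame is read off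
ONE package (at an integral representative `(u₀, r₀)` of `c`, ★ `exists_principalRep`; `m.γ = 1 ⇒ Ψ ∘ J = i·Ψ`, ★ `apply_mulVec_of_γ_eq_one`),
★ `exists_alignedChart_of_frameJLinear` aligns the chart (`Z` holomorphic, `Φ = Π_Z`, TRANSPORT of every frame package to a normal-form
package for the re-framed `ex`), and the (G)∕(ADM) conjuncts are the two halves of TRANSPORT fed with `FLAT`'s packages.
[cite: BirkenhakeLange2004, §8.7 Lemma 8.7.1 p. 230] [cite: Milne2005ShimuraVarieties, §6 Thm. 6.11 p. 74] -/
theorem stub_ALIGN : ALIGN := by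
  intro g N δ _hg hδ hN 𝓜 c Sc ιc unif _hu₁ _hu₂ _hu₃ _hu₄ _hu₅ _hU3 T d _i₁ _i₂ _i₃ ψ MT _i₄ _i₅ _i₆ φT hT MA _i₇ _i₈ _i₉ φA _hA U _hU
    s _hs _hsd _hlift V' _hV'o _hV'U Φ₁ ex₁ Z hZ hC₁ _hG₁ hADM₁
  -- an integral representative `(u₀, r₀)` of `c`: ONE package suffices to read the `J(Z t)`-linearity of the frame `Φ₁ t`
  obtain ⟨u₀, r₀, h₁, h₂, h₃, h₄, h₅⟩ := exists_principalRep δ (by omega : N ≠ 0) c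
  have hJ : ∀ t ∈ V', ∀ x, Φ₁ t (jOfSiegel δ (Z t) *ᵥ x) = Complex.I • Φ₁ t x := by
    intro t ht x
    obtain ⟨m₁, Θ, Λ, -, -, -, hγ₁, hΨ₁, -⟩ := hADM₁ u₀ r₀ h₁ h₂ h₃ h₄ h₅ t ht
    simpa only [hΨ₁] using m₁.apply_mulVec_of_γ_eq_one hγ₁ x
  obtain ⟨hZd, Φ, ex, hT, hC, hTR⟩ :=
    exists_alignedChart_of_frameJLinear hδ 𝓜 ιc T d ψ MT φT hT MA φA V' Φ₁ ex₁ hC₁ Z hZ hJ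
  exact ⟨Φ, ex, hZd, hT, hC, fun t ht => (hTR r₀ t ht (hADM₁ u₀ r₀ h₁ h₂ h₃ h₄ h₅ t ht)).1,
    fun u r h₁' h₂' h₃' h₄' h₅' t ht => (hTR r t ht (hADM₁ u r h₁' h₂' h₃' h₄' h₅' t ht)).2⟩

/-- **Organ O5 — PAID** (LA7-p02 (g0), ★ p847965 `SiegelUniversalFamilyChartMatch`): at an integral representative `(u₀, r₀)` of `c`
(★ `exists_principalRep`) the (ADM) package at `Z t` and the `ADMNF` package at `s t` are two admissible markings of ONE fibre, so
`⟨s t⟩ = M_t • ⟨Z t⟩` with `M_t ∈ Γ_δ(N)` (★ `exists_siegelLevelGroup_smul_ratRep_of_lifts`); `Z`, `s` continuous and `Z t₀ = s t₀` force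
`Z = s` on an open `V'' ∋ t₀` (★ LIFT-UNIQ p847785 `exists_open_eqOn_of_exists_gDHom_smul`: `Γ_δ(N)` acts freely and properly
discontinuously, `N ≥ 3`); the chart restricts (`.mono`) and TAUT∕(ADM) are transported along `Z t = s t`; head `match_chart` = `MATCH` minus
its unused binders. [cite: Lange2023AbelianVarietiesComplex, §3.4 Prop. 3.4.8 + Ex. 3.4.5 (7) pp. 190–191]
[cite: BirkenhakeLange2004, §8.8 pp. 232–234] [cite: Milne2005ShimuraVarieties, §6 Thm. 6.11 p. 74] -/
theorem stub_MATCH : MATCH := by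
  intro g N δ hg hδ hN 𝓜 c Sc ιc _unif _ _ _ _ _ _ T d _ _ _ ψ MT _ _ _ φT hT MA _ _ _ φA _ U _ s hs hsd _ t₀ V' hV'o ht₀ hV'U Z hZ hZd
    hZ₀ Φ₂ ex₂ hΦ₂ hex₂ hG hADMZ hADMs
  exact Literature.AlgebraicGeometry.ModuliOfAbelianVarieties.SiegelUniversalFamilyChartMatch.match_chart g N δ hg hδ hN 𝓜 c Sc ιc T d
    ψ MT φT hT MA φA U s hs hsd t₀ V' hV'o ht₀ hV'U Z hZ hZd hZ₀ Φ₂ ex₂ hΦ₂ hex₂ hG hADMZ hADMs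

/-- **Organ O6 — PAID** (LA7-p02 (g0), ★ p847935 `SiegelUniversalFamilyChartGluing`): the P-3 fibre normal form is RIGID
(`fibreDatum_rigid`: two charts in normal form at `s` have the same frame `Π_s` and the same fibre map, by ★ `toFun_eq_toFun_of_lifts`
[Milne Thm. 6.11 ∕ Serre's lemma, `N ≥ 3`] + injectivity of `φA` and of `fibrePointToLeft`), so the local charts glue along `U`
(★ CHART-GLUE `IsRelExpChartOn.exists_chart_of_local_of_rigid`); head `chart_of_local` = `GLUE` minus its unused binders.
[cite: Milne2005ShimuraVarieties, §6 Thm. 6.11 p. 74] [cite: Lange2023AbelianVarietiesComplex, §3.4 Prop. 3.4.8 p. 190] -/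
theorem stub_GLUE : GLUE := by
  intro g N δ hg hδ hN 𝓜 c Sc ιc _unif _ _ _ _ _ _ T d _ _ _ ψ MT _ _ _ φT hT MA _ _ _ φA hA U _ s hs _ _ hloc
  exact Literature.AlgebraicGeometry.ModuliOfAbelianVarieties.SiegelUniversalFamilyChartGluing.chart_of_local g N δ hg hδ hN 𝓜 c
    Sc ιc T d ψ MT φT hT MA φA hA U s hs hloc

/-! ## The head: the organs compose to the socket's type (PROVED, no `sorry`) -/

/-- **HEAD `stub_UNIVFAM_of_organs`: RELEXP → ADMNF → FLAT → ALIGN → MATCH → GLUE → P-3.**  Intro P-3's binders; by `GLUE` it suffices to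
chart a neighbourhood of each `t₀ ∈ U`; P-1 at `(T, d, P.A, g, P.relDim, MT, φT, MA, φA)` charts some `U₀ ∋ t₀`; `FLAT` normalises and
propagates on `V' ∋ t₀`; `ALIGN` re-frames to `Π_Z`; `MATCH` identifies `Z = s` on `V'' ∋ t₀`.
[cite: Lange2023AbelianVarietiesComplex, §3.4 Prop. 3.4.1 + Lemma 3.4.7 + Prop. 3.4.8 + Ex. 3.4.5 (7) pp. 186–191] [cite: BirkenhakeLange2004, §8.7–§8.8 pp. 229–234] -/
theorem stub_UNIVFAM_of_organs (h₁ : relativeExponentialUniformisation) (h₂ : ADMNF) (h₃ : FLAT) (h₄ : ALIGN) (h₅ : MATCH)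
    (h₆ : GLUE) : Literature.AlgebraicGeometry.ModuliOfAbelianVarieties.siegelUniversalFamilyUniformisation := by
  intro g N δ hg hδ hN 𝓜 c Sc ιc unif hu₁ hu₂ hu₃ hu₄ hu₅ hU3 T d _i₁ _i₂ _i₃ ψ MT _i₄ _i₅ _i₆ φT hT MA _i₇ _i₈ _i₉ φA hA U hU s hs hsd
    hlift
  refine h₆ g N δ hg hδ hN 𝓜 c Sc ιc unif hu₁ hu₂ hu₃ hu₄ hu₅ hU3 T d ψ MT φT hT MA φA hA U hU s hs hsd hlift ?_
  intro t₀ ht₀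
  -- O2: the normal-form packages along `U`
  have hNF := h₂ g N δ hg hδ hN 𝓜 c Sc ιc unif hu₁ hu₂ hu₃ hu₄ hu₅ hU3 T d ψ MT φT hT MA φA hA U hU s hs hsd hlift
  -- O1: a relative exponential chart of `(P.A)^an → T^an` near `t₀`
  obtain ⟨U₀, ht₀U₀, Φ₀, ex₀, hC₀, hG₀⟩ :=
    h₁ T d _ g (PolarizedAbelianSchemeWithLevel.relDim _) MT φT hT MA φA hA t₀
  -- O3: normalise at `t₀`, propagate along the frame
  obtain ⟨V', hV'o, ht₀V', hV'U, Φ₁, ex₁, Z, hZ, hZ₀, hC₁, hG₁, hADM₁⟩ :=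
    h₃ g N δ hg hδ hN 𝓜 c Sc ιc unif hu₁ hu₂ hu₃ hu₄ hu₅ hU3 T d ψ MT φT hT MA φA hA U hU s hs hsd hlift
      t₀ ht₀ U₀ Φ₀ ex₀ ht₀U₀ hC₀ hG₀ hNF
  -- O4: Riemann relations, re-frame to `Π_Z`
  obtain ⟨Φ₂, ex₂, hZd, hT₂, hC₂, hG₂, hADM₂⟩ :=
    h₄ g N δ hg hδ hN 𝓜 c Sc ιc unif hu₁ hu₂ hu₃ hu₄ hu₅ hU3 T d ψ MT φT hT MA φA hA U hU s hs hsd hlift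
      V' hV'o hV'U Φ₁ ex₁ Z hZ hC₁ hG₁ hADM₁
  -- O5: `Z = s` near `t₀`
  obtain ⟨V'', hV''o, ht₀V'', hV''U, Φ, ex, hT, hC, hG, hADM⟩ :=
    h₅ g N δ hg hδ hN 𝓜 c Sc ιc unif hu₁ hu₂ hu₃ hu₄ hu₅ hU3 T d ψ MT φT hT MA φA hA U hU s hs hsd hlift
      t₀ V' hV'o ht₀V' hV'U Z hZ hZd hZ₀ Φ₂ ex₂ hT₂ hC₂ hG₂ hADM₂ hNF
  exact ⟨V'', hV''o, ht₀V'', hV''U, Φ, ex, hT, hC, hG, hADM⟩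

/-- **The socket's type, from the organs** (the leaf's closing term once O1–O6 are paid: `stub_UNIVFAM := stub_UNIVFAM_closed`).
[cite: Lange2023AbelianVarietiesComplex, §3.4 pp. 186–191] -/
theorem stub_UNIVFAM_closed : Literature.AlgebraicGeometry.ModuliOfAbelianVarieties.siegelUniversalFamilyUniformisation :=
  stub_UNIVFAM_of_organs stub_RELEXP stub_ADMNF stub_FLAT stub_ALIGN stub_MATCH stub_GLUE

/- TIE (β layering): the E-line's registered `stub_UNIVFAM` (`Lines/F0_P6a_PELWitnessE.lean` :654) and `stub_UNIVFAM_closed` have the SAME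
type — the constant ★ P-3 `siegelUniversalFamilyUniformisation` — so the E-line's next edition imports this leaf and writes
`theorem stub_UNIVFAM : … := StubUNIVFAM.stub_UNIVFAM_closed`; this leaf imports no E-line theorem (no cycle).  The by-import `rfl` tie of
ED. 1∕2 candidates v1–v6 (which imported the E-line) is run by the boxes (LAref-E ∕ LA-ref2) in a probe importing both modules. -/
example : type_of% @stub_UNIVFAM_closed = Literature.AlgebraicGeometry.ModuliOfAbelianVarieties.siegelUniversalFamilyUniformisation := rfl

end Summit.HodgeConjecture.HodgeConjecture.Cruxes.HLiu418.StubUNIVFAM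

end
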